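import Mathlib.Algebra.Polynomial.Lifts
import Mathlib.Analysis.Normed.Module.FiniteDimension
import Mathlib.FieldTheory.Minpoly.IsIntegrallyClosed
import Mathlib.LinearAlgebra.TensorProduct.Pi
import Mathlib.LinearAlgebra.TensorProduct.RightExactness
import Mathlib.RingTheory.DedekindDomain.IntegralClosure
import Mathlib.RingTheory.Flat.Basic
import Mathlib.RingTheory.PowerSeries.Evaluation
import Mathlib.RingTheory.PowerSeries.Ideal
import Literature.NumberTheory.GaloisRepresentations.AbsGaloisGroupProofs
import Literature.NumberTheory.GaloisRepresentations.FramedRepBaseChange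
import Literature.NumberTheory.GaloisRepresentations.OrdinaryRegular
import Literature.NumberTheory.GaloisRepresentations.PAdicHodgeProofs
import Literature.NumberTheory.GaloisRepresentations.PotentialDiagonalizabilityCriteria
import Literature.NumberTheory.Automorphic.ReciprocityGLnQlModelProofs
import HarnessLib

/-!
# Proof of BLGGT Lemma 1.4.3 (1): representations with an invariant complete flag are
# potentially diagonalizable

Sibling proof file of `PotentialDiagonalizabilityCriteria.lean`, discharging the named fact
`Literature.NumberTheory.GaloisRepresentations.blggt2014_lemma_1_4_3_1` (Barnet-Lamb–Gee–Geraghty–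
Taylor, *Potential automorphy and change of weight*, Ann. of Math. 179 (2014), §1.4 Lemma 1.4.3 (1))
as `blggt2014_lemma_1_4_3_1_holds`.  Everything in this file is a proved `theorem`; it declares no
definitions and no named facts (auxiliary objects — sub-representations, the diagonal
representation, the connecting family — are provided by existence theorems).

## The printed proof and the formal one

BLGGT prove Lemma 1.4.3 (1) in one sentence (arXiv:1010.2561, p. 15): "After passing to a finite
extension so that `ρ̄` becomes trivial and each `gr^i ρ` becomes crystalline, the first part follows
from item (semisimp)", where (semisimp) (§1.4, p. 14: "Suppose that `ρ₁` is potentially crystalline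
and that `ρ̄₁` is semisimple. Let `Fil^i` be an invariant filtration on `ρ₁` by `𝒪`-direct summands,
then `ρ₁ ∼ ⊕ gr^i ρ₁`") is proved "in the same way as remark (dia) of the previous section", i.e.
(§1.3, pp. 12–13) by the family `ρ = h ρ₁ h⁻¹ : G_K → GL_n(𝒪⟨t⟩)`, `h e_{i,j} = t^i e_{i,j}`, over a
complete noetherian local domain, which specialises to `ρ₁` at `t = 1` and to `⊕ gr^i ρ₁` at
`t = 0`.  The tree renders `ρ₁ ∼ ρ₂` (`ConnectsOver`, file `PotentialDiagonalizability`) precisely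
by such families (`ConnectingFamily`: a representation over a complete noetherian local domain `A`
with residue field `k_E`, two `𝒪_E`-rational points, all `ℚ̄_p`-points crystalline), so the formal
proof IS the construction of this family, with the following bookkeeping forced by the tree's
definitions.

* **The field.**  Crystallinity is relative to abstract period-ring data `𝔅 K'`, one datum for each
  finite `K'/K`, with no relation between different `K'`; hence everything happens over the one
  field `K₁` over which `ρ` is crystalline (`IsPotentiallyCrystallineFn`), and "passing to a finite
  extension" is replaced by changes of frame, which `IsPotentiallyDiagonalizable` allows (BLGGT
  Lemma 1.4.1).
* **Integrality** (`Step 3` of the main proof).  After conjugating `ρ|_{Γ_{K₁}}` into upper-triangular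
  form (the flag) all entries lie in a finite `E₀/ℚ_p` (Baire: `exists_hasQlModel_holds`); the
  diagonal characters of the compact group `Γ_{K₁}` have norm one and the other entries are bounded,
  so conjugation by `diag(p^{-mi})` gives an upper-triangular `F : Γ_{K₁} → GL_n(𝒪_{E₀})`.
* **The family** (`exists_connectingFamily_of_integral`).  `A = 𝒪_{E₀}⟦t⟧`,
  `ρ_t(σ)_{ij} = t^{j-i} F(σ)_{ij}` (`= h F h⁻¹` with `h = diag(t^{-i})`; the printed `𝒪⟨t⟩` and
  `t ↦ 1` become `𝒪⟦t⟧` and the `𝒪`-point `t ↦ p`, whose specialisation `diag(p^{-i}) F diag(p^i)`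
  is absorbed in the change of frame); `t ↦ 0` gives `⊕ gr^i F = diag(F_{11}, …, F_{nn})`, the
  crystalline sum of characters.  A `ℚ̄_p`-point `t ↦ c` specialises to a `GL_n(ℚ̄_p)`-conjugate of
  `F` (`c ≠ 0`) or to `⊕ gr^i F` (`c = 0`).
* **"each `gr^i ρ` becomes crystalline".**  Sub-objects, quotients and sums of `B`-admissible
  representations are `B`-admissible for every regular `(ℚ_p, Γ)`-ring `B` (Fontaine, Astérisque 223,
  Exposé III, Prop. 1.5.2): proved here from the tree's Fontaine inequality `finrank_D_le_holds` and
  the exactness of `B ⊗_{ℚ_p} −` (`PeriodRingData.isAdmissible_of_shortExact`,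
  `PeriodRingData.isAdmissible_pi_iff`, `PeriodRingData.isAdmissible_iff_of_equiv`); at the level of
  finite models (`IsCrystallineFn`) this gives conjugation invariance (`IsCrystallineFn.conj`, with a
  descent along finite extensions of the coefficient field, `isAdmissible_restrictScalars_of_le`) and
  crystallinity of the diagonal part (`IsCrystallineFn.diagonal_of_isUpperTriangular`).
* **The ring `𝒪_{E₀}⟦t⟧`.**  `𝒪_{E₀} = padicCoeffRing E₀` is local, Noetherian (it is the integral
  closure of `ℤ_p` in `E₀`: `‖x‖ ≤ 1` iff the minimal polynomial has `ℤ_p`-coefficients, Mathlib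
  `spectralValue_le_one_iff`, `integralClosure.isNoetherianRing`) and `𝔪`-adically complete
  (`isAdicComplete_padicCoeffRing`); power series over a complete local ring are complete for the
  maximal ideal (`powerSeries_isAdicComplete_maximalIdeal`); evaluation at `p` is Mathlib's
  `PowerSeries.eval₂Hom` (`𝒪_{E₀}` is linearly topologised, `isLinearTopology_padicCoeffRing`).
* **Points after restriction** (`ConnectsOver` restricts the points along `absGaloisRestrict K₁ K₁`,
  an inner automorphism: `absGaloisRestrict_self_eq_conj`, from `absGaloisRestrict_isConj_of_algHom_holds`).

## References

* T. Barnet-Lamb, T. Gee, D. Geraghty, R. Taylor, *Potential automorphy and change of weight*,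
  Ann. of Math. 179 (2014) 501–609: §1.3 proof of (dia) (arXiv:1010.2561 p. 12 l. 61 – p. 13 l. 9),
  §1.4 (semisimp) (p. 14 l. 37), Lemma 1.4.1, Lemma 1.4.3 and its proof (p. 15 l. 84–91).
  [BarnetlambEtAl2014]
* J.-M. Fontaine, *Représentations `p`-adiques semi-stables*, Astérisque 223 (1994), Exposé III,
  Prop. 1.5.2 (sub-objects, quotients, sums of admissible representations).
* J.-P. Serre, *Local Fields*, II §§1–2 (integers of a finite extension of `ℚ_p`).
* Mathlib: `PowerSeries.eval₂Hom`, `IsAdicComplete`, `integralClosure.isNoetherianRing`,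
  `spectralValue_le_one_iff`, `TensorProduct.piRight`, `lTensor_exact`,
  `Module.Flat.lTensor_preserves_injective_linearMap`; tree: `exists_hasQlModel_holds`
  (`Automorphic/ReciprocityGLnQlModelProofs`), `FramedRep.exists_baseChange_eq`,
  `absGaloisRestrict_isConj_of_algHom_holds`, `PeriodRingData.finrank_D_le_holds`,
  `FramedRep.IsUpperTriangular` (`OrdinaryRegular`).
-/

open Field
open scoped Matrix

noncomputable section

open scoped TensorProduct
open TensorProduct

namespace Literature.NumberTheory.GaloisRepresentations

namespace PeriodRingData

section Closure

set_option maxSynthPendingDepth 3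

universe u v v' w w'

variable {Γ : Type u} [Group Γ] [TopologicalSpace Γ] {P : Type v} {E : Type v'} [Field P]
  [TopologicalSpace P] [Field E] [Algebra P E]
  (𝔅 : PeriodRingData.{u, v, v', w} Γ P E)

section Finite

variable {M : Type w'} [AddCommGroup M] [Module P M] [TopologicalSpace M]
  (ρ : ContinuousRep Γ P M)

/-- `D_B(V)` is finite-dimensional over `E` (its `E`-rank is at most `dim_P V`, by the injectivity
of the comparison map).  Ref: Fontaine, Astérisque 223 (1994), Exposé III, Prop. 1.4.2. [folklore] -/
theorem finite_D [FiniteDimensional P M] : Module.Finite E (𝔅.D ρ) := by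
  have hrank : Module.rank E (𝔅.D ρ) ≤ Module.finrank P M := by
    refine rank_le fun s hs => ?_
    have h1 : LinearIndependent E (fun i : s => ((i : 𝔅.D ρ) : 𝔅.B ⊗[P] M)) :=
      hs.map' (𝔅.D ρ).subtype (Submodule.ker_subtype _)
    have h2 : LinearIndependent 𝔅.B (fun i : s => ((i : 𝔅.D ρ) : 𝔅.B ⊗[P] M)) :=
      𝔅.linearIndependent_of_mem_D ρ (fun i => (i : 𝔅.D ρ).2) h1
    have h3 := h2.fintype_card_le_finrank
    rw [Fintype.card_coe] at h3
    exact h3.trans_eq Module.finrank_baseChange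
  exact Module.rank_lt_aleph0_iff.mp (hrank.trans_lt (Cardinal.natCast_lt_aleph0))

end Finite

section Map

variable {M₁ : Type w'} [AddCommGroup M₁] [Module P M₁] [TopologicalSpace M₁]
  {M₂ : Type w'} [AddCommGroup M₂] [Module P M₂] [TopologicalSpace M₂]
  (ρ₁ : ContinuousRep Γ P M₁) (ρ₂ : ContinuousRep Γ P M₂)

omit [TopologicalSpace Γ] [TopologicalSpace P] [TopologicalSpace M₁] [TopologicalSpace M₂] in
/-- The `E`-linear map `1 ⊗ f : B ⊗_P V₁ → B ⊗_P V₂` agrees with Mathlib's `lTensor`. [folklore] -/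
theorem algebraTensorModule_map_id_apply (f : M₁ →ₗ[P] M₂) (x : 𝔅.B ⊗[P] M₁) :
    AlgebraTensorModule.map (LinearMap.id : 𝔅.B →ₗ[E] 𝔅.B) f x = LinearMap.lTensor 𝔅.B f x := by
  induction x using TensorProduct.induction_on with
  | zero => simp
  | tmul b m => simp
  | add x y hx hy => rw [map_add, map_add, hx, hy]

/-- `1 ⊗ f` intertwines the diagonal actions when `f` is equivariant. [folklore] -/
theorem algebraTensorModule_map_tensorRep (f : M₁ →ₗ[P] M₂)
    (hf : ∀ (σ : Γ) (x : M₁), f (ρ₁ σ x) = ρ₂ σ (f x)) (σ : Γ) (x : 𝔅.B ⊗[P] M₁) :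
    AlgebraTensorModule.map (LinearMap.id : 𝔅.B →ₗ[E] 𝔅.B) f (𝔅.tensorRep ρ₁ σ x) =
      𝔅.tensorRep ρ₂ σ (AlgebraTensorModule.map (LinearMap.id : 𝔅.B →ₗ[E] 𝔅.B) f x) := by
  induction x using TensorProduct.induction_on with
  | zero => simp
  | tmul b m => simp [hf]
  | add x y hx hy => simp only [map_add, hx, hy]

/-- `1 ⊗ f` maps `D(V₁)` into `D(V₂)` for `f` equivariant. [folklore] -/
theorem algebraTensorModule_map_mem_D (f : M₁ →ₗ[P] M₂)
    (hf : ∀ (σ : Γ) (x : M₁), f (ρ₁ σ x) = ρ₂ σ (f x)) {x : 𝔅.B ⊗[P] M₁} (hx : x ∈ 𝔅.D ρ₁) :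
    AlgebraTensorModule.map (LinearMap.id : 𝔅.B →ₗ[E] 𝔅.B) f x ∈ 𝔅.D ρ₂ :=
  (𝔅.mem_D_iff ρ₂ _).2 fun σ => by
    rw [← 𝔅.algebraTensorModule_map_tensorRep ρ₁ ρ₂ f hf σ x, (𝔅.mem_D_iff ρ₁ x).1 hx σ]

/-- **Functoriality of `D_B`**: an equivariant `P`-linear map `f : V₁ → V₂` induces an `E`-linear
map `D(f) : D_B(V₁) → D_B(V₂)`, `x ↦ (1 ⊗ f) x` (stated as an existence theorem).
Ref: Fontaine, Astérisque 223 (1994), Exposé III §1.5. [folklore] -/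
theorem exists_DMap (f : M₁ →ₗ[P] M₂) (hf : ∀ (σ : Γ) (x : M₁), f (ρ₁ σ x) = ρ₂ σ (f x)) :
    ∃ F : 𝔅.D ρ₁ →ₗ[E] 𝔅.D ρ₂, ∀ x : 𝔅.D ρ₁,
      (F x : 𝔅.B ⊗[P] M₂) = AlgebraTensorModule.map (LinearMap.id : 𝔅.B →ₗ[E] 𝔅.B) f x :=
  ⟨(AlgebraTensorModule.map (LinearMap.id : 𝔅.B →ₗ[E] 𝔅.B) f ∘ₗ (𝔅.D ρ₁).subtype).codRestrict
      (𝔅.D ρ₂) fun x => 𝔅.algebraTensorModule_map_mem_D ρ₁ ρ₂ f hf x.2,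
    fun _ => rfl⟩

/-- **`B`-admissibility is invariant under isomorphism of representations**: an equivariant
`P`-linear isomorphism `V₁ ≃ V₂` induces `D_B(V₁) ≃ D_B(V₂)`.
Ref: Fontaine, Astérisque 223 (1994), Exposé III §1.5. [folklore] -/
theorem finrank_D_eq_of_equiv (e : M₁ ≃ₗ[P] M₂) (he : ∀ (σ : Γ) (x : M₁), e (ρ₁ σ x) = ρ₂ σ (e x)) :
    Module.finrank E (𝔅.D ρ₁) = Module.finrank E (𝔅.D ρ₂) := by
  have he' : ∀ (σ : Γ) (y : M₂), e.symm (ρ₂ σ y) = ρ₁ σ (e.symm y) := fun σ y => by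
    apply e.injective
    rw [he, e.apply_symm_apply, e.apply_symm_apply]
  obtain ⟨F, hF⟩ := 𝔅.exists_DMap ρ₁ ρ₂ e.toLinearMap he
  obtain ⟨G, hG⟩ := 𝔅.exists_DMap ρ₂ ρ₁ e.symm.toLinearMap he'
  have hGF : ∀ x, G (F x) = x := fun x => by
    apply Subtype.ext
    rw [hG, hF, ← LinearMap.comp_apply, ← AlgebraTensorModule.map_comp]
    have : (e.symm.toLinearMap ∘ₗ e.toLinearMap) = LinearMap.id := by
      ext; simp
    rw [this, LinearMap.comp_id, AlgebraTensorModule.map_id, LinearMap.id_apply]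
  have hFG : ∀ y, F (G y) = y := fun y => by
    apply Subtype.ext
    rw [hF, hG, ← LinearMap.comp_apply, ← AlgebraTensorModule.map_comp]
    have : (e.toLinearMap ∘ₗ e.symm.toLinearMap) = LinearMap.id := by
      ext; simp
    rw [this, LinearMap.comp_id, AlgebraTensorModule.map_id, LinearMap.id_apply]
  exact LinearEquiv.finrank_eq
    { toLinearMap := F, invFun := G, left_inv := hGF, right_inv := hFG }

/-- **`B`-admissibility is invariant under isomorphism of representations.**
Ref: Fontaine, Astérisque 223 (1994), Exposé III §1.5. [folklore] -/
theorem isAdmissible_iff_of_equiv (e : M₁ ≃ₗ[P] M₂)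
    (he : ∀ (σ : Γ) (x : M₁), e (ρ₁ σ x) = ρ₂ σ (e x)) :
    𝔅.IsAdmissible ρ₁ ↔ 𝔅.IsAdmissible ρ₂ := by
  rw [IsAdmissible, IsAdmissible, 𝔅.finrank_D_eq_of_equiv ρ₁ ρ₂ e he, e.finrank_eq]

end Map

section ShortExact

variable {M₁ : Type w'} [AddCommGroup M₁] [Module P M₁] [TopologicalSpace M₁]
  {M₂ : Type w'} [AddCommGroup M₂] [Module P M₂] [TopologicalSpace M₂]
  {M₃ : Type w'} [AddCommGroup M₃] [Module P M₃] [TopologicalSpace M₃]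
  (ρ₁ : ContinuousRep Γ P M₁) (ρ₂ : ContinuousRep Γ P M₂) (ρ₃ : ContinuousRep Γ P M₃)

/-- **Left exactness of `D_B`, numerically**: for an exact sequence of representations
`0 → V₁ → V₂ → V₃ → 0`, `dim_E D(V₂) ≤ dim_E D(V₁) + dim_E D(V₃)` (the kernel of `D(V₂) → D(V₃)`
is the image of `D(V₁)`, by exactness of `B ⊗_P −` and injectivity of `B ⊗ V₁ → B ⊗ V₂`).
Ref: Fontaine, Astérisque 223 (1994), Exposé III, Prop. 1.5.2. [folklore] -/
theorem finrank_D_le_add_of_shortExact [FiniteDimensional P M₁] [FiniteDimensional P M₂]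
    [FiniteDimensional P M₃] (f : M₁ →ₗ[P] M₂) (g : M₂ →ₗ[P] M₃)
    (hf : ∀ (σ : Γ) (x : M₁), f (ρ₁ σ x) = ρ₂ σ (f x))
    (hg : ∀ (σ : Γ) (x : M₂), g (ρ₂ σ x) = ρ₃ σ (g x))
    (hinj : Function.Injective f) (hsurj : Function.Surjective g) (hex : Function.Exact f g) :
    Module.finrank E (𝔅.D ρ₂) ≤ Module.finrank E (𝔅.D ρ₁) + Module.finrank E (𝔅.D ρ₃) := by
  haveI := 𝔅.finite_D ρ₁
  haveI := 𝔅.finite_D ρ₂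
  haveI := 𝔅.finite_D ρ₃
  obtain ⟨F, hF⟩ := 𝔅.exists_DMap ρ₁ ρ₂ f hf
  obtain ⟨G, hG⟩ := 𝔅.exists_DMap ρ₂ ρ₃ g hg
  -- the kernel of `D(g)` lies in the image of `D(f)`
  have hker : LinearMap.ker G ≤ LinearMap.range F := by
    intro x hx
    rw [LinearMap.mem_ker] at hx
    have hx0 : LinearMap.lTensor 𝔅.B g (x : 𝔅.B ⊗[P] M₂) = 0 := by
      rw [← 𝔅.algebraTensorModule_map_id_apply g, ← hG, hx]; rfl
    have hexT := lTensor_exact 𝔅.B hex hsurj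
    obtain ⟨y, hy⟩ := (hexT _).1 hx0
    have hinjT : Function.Injective (LinearMap.lTensor 𝔅.B f) :=
      Module.Flat.lTensor_preserves_injective_linearMap f hinj
    have hyD : y ∈ 𝔅.D ρ₁ := (𝔅.mem_D_iff ρ₁ y).2 fun σ => hinjT <| by
      rw [← 𝔅.algebraTensorModule_map_id_apply f, ← 𝔅.algebraTensorModule_map_id_apply f,
        𝔅.algebraTensorModule_map_tensorRep ρ₁ ρ₂ f hf, 𝔅.algebraTensorModule_map_id_apply f, hy]
      exact (𝔅.mem_D_iff ρ₂ _).1 x.2 σ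
    refine ⟨⟨y, hyD⟩, Subtype.ext ?_⟩
    rw [hF, 𝔅.algebraTensorModule_map_id_apply f]
    exact hy
  have h1 := LinearMap.finrank_range_add_finrank_ker G
  have h2 : Module.finrank E (LinearMap.range G) ≤ Module.finrank E (𝔅.D ρ₃) :=
    Submodule.finrank_le _
  have h3 : Module.finrank E (LinearMap.ker G) ≤ Module.finrank E (LinearMap.range F) :=
    Submodule.finrank_mono hker
  have h4 : Module.finrank E (LinearMap.range F) ≤ Module.finrank E (𝔅.D ρ₁) :=
    LinearMap.finrank_range_le F
  omega

/-- **Sub-objects and quotients of `B`-admissible representations are `B`-admissible**: for an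
exact sequence `0 → V₁ → V₂ → V₃ → 0` of finite-dimensional representations with `V₂`
admissible, `V₁` and `V₃` are admissible (left exactness of `D_B` and Fontaine's inequality
`dim D(V) ≤ dim V`).  Ref: Fontaine, Astérisque 223 (1994), Exposé III, Prop. 1.5.2;
Fontaine–Ouyang, Thm. 2.13 (2). [folklore] -/
theorem isAdmissible_of_shortExact [FiniteDimensional P M₁] [FiniteDimensional P M₂]
    [FiniteDimensional P M₃] (f : M₁ →ₗ[P] M₂) (g : M₂ →ₗ[P] M₃)
    (hf : ∀ (σ : Γ) (x : M₁), f (ρ₁ σ x) = ρ₂ σ (f x))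
    (hg : ∀ (σ : Γ) (x : M₂), g (ρ₂ σ x) = ρ₃ σ (g x))
    (hinj : Function.Injective f) (hsurj : Function.Surjective g) (hex : Function.Exact f g)
    (h₂ : 𝔅.IsAdmissible ρ₂) : 𝔅.IsAdmissible ρ₁ ∧ 𝔅.IsAdmissible ρ₃ := by
  have hD := 𝔅.finrank_D_le_add_of_shortExact ρ₁ ρ₂ ρ₃ f g hf hg hinj hsurj hex
  have hD1 : Module.finrank E (𝔅.D ρ₁) ≤ Module.finrank P M₁ := 𝔅.finrank_D_le_holds ρ₁
  have hD3 : Module.finrank E (𝔅.D ρ₃) ≤ Module.finrank P M₃ := 𝔅.finrank_D_le_holds ρ₃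
  have hM : Module.finrank P M₂ = Module.finrank P M₁ + Module.finrank P M₃ := by
    have h1 := LinearMap.finrank_range_add_finrank_ker g
    rw [LinearMap.range_eq_top.2 hsurj, finrank_top, LinearMap.exact_iff.1 hex,
      LinearMap.finrank_range_of_inj hinj] at h1
    omega
  rw [IsAdmissible] at h₂ ⊢
  rw [IsAdmissible]
  omega

end ShortExact

section Pi

variable {ι : Type} [Fintype ι] [DecidableEq ι] {M : ι → Type w'} [∀ i, AddCommGroup (M i)]
  [∀ i, Module P (M i)] [∀ i, TopologicalSpace (M i)]
  (ρ : ContinuousRep Γ P (∀ i, M i)) (ρs : ∀ i, ContinuousRep Γ P (M i))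

/-- `piRight` intertwines the diagonal action on `B ⊗ (Π Vᵢ)` with the componentwise diagonal
actions, for a representation acting componentwise. [folklore] -/
theorem piRight_tensorRep (h : ∀ (σ : Γ) (x : ∀ i, M i) (i : ι), ρ σ x i = ρs i σ (x i)) (σ : Γ)
    (x : 𝔅.B ⊗[P] (∀ i, M i)) (i : ι) :
    piRight P E 𝔅.B M (𝔅.tensorRep ρ σ x) i = 𝔅.tensorRep (ρs i) σ (piRight P E 𝔅.B M x i) := by
  induction x using TensorProduct.induction_on with
  | zero => simp
  | tmul b m =>
      simp only [tensorRep_apply_tmul, piRight_apply, piRightHom_tmul]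
      rw [h]
  | add x y hx hy => simp only [map_add, Pi.add_apply, hx, hy]

/-- **`D_B` commutes with finite products**: for a representation on `Π Vᵢ` acting componentwise,
`dim_E D(Π Vᵢ) = Σ dim_E D(Vᵢ)`.  Ref: Fontaine, Astérisque 223 (1994), Exposé III, Prop. 1.5.2
(`D_B(V₁ ⊕ V₂) = D_B(V₁) ⊕ D_B(V₂)`). [folklore] -/
theorem finrank_D_pi [∀ i, FiniteDimensional P (M i)]
    (h : ∀ (σ : Γ) (x : ∀ i, M i) (i : ι), ρ σ x i = ρs i σ (x i)) :
    Module.finrank E (𝔅.D ρ) = ∑ i, Module.finrank E (𝔅.D (ρs i)) := by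
  haveI := fun i => 𝔅.finite_D (ρs i)
  let Φ := piRight P E 𝔅.B M
  have hto : ∀ (x : 𝔅.D ρ) (i : ι), Φ x i ∈ 𝔅.D (ρs i) := fun x i =>
    (𝔅.mem_D_iff (ρs i) _).2 fun σ => by
      rw [← 𝔅.piRight_tensorRep ρ ρs h σ, (𝔅.mem_D_iff ρ _).1 x.2 σ]
  have hinv : ∀ y : ∀ i, 𝔅.D (ρs i), Φ.symm (fun i => (y i : 𝔅.B ⊗[P] M i)) ∈ 𝔅.D ρ := fun y =>
    (𝔅.mem_D_iff ρ _).2 fun σ => by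
      apply Φ.injective
      funext i
      rw [𝔅.piRight_tensorRep ρ ρs h σ, LinearEquiv.apply_symm_apply]
      exact (𝔅.mem_D_iff (ρs i) _).1 (y i).2 σ
  let e : 𝔅.D ρ ≃ₗ[E] ∀ i, 𝔅.D (ρs i) :=
    { toFun := fun x i => ⟨Φ x i, hto x i⟩
      map_add' := fun x y => by
        funext i; apply Subtype.ext
        simp only [Submodule.coe_add, map_add, Pi.add_apply]
      map_smul' := fun c x => by
        funext i; apply Subtype.ext
        simp only [Submodule.coe_smul, map_smul, Pi.smul_apply, RingHom.id_apply]
      invFun := fun y => ⟨Φ.symm (fun i => (y i : 𝔅.B ⊗[P] M i)), hinv y⟩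
      left_inv := fun x => by
        apply Subtype.ext
        change Φ.symm (fun i => Φ x i) = x
        exact Φ.symm_apply_apply x
      right_inv := fun y => by
        funext i; apply Subtype.ext
        change Φ (Φ.symm fun i => (y i : 𝔅.B ⊗[P] M i)) i = y i
        rw [LinearEquiv.apply_symm_apply] }
  rw [e.finrank_eq, Module.finrank_pi_fintype]

/-- **Finite products (direct sums) of representations are `B`-admissible iff all factors are**
(`dim D` and `dim` are both additive, and `dim D(Vᵢ) ≤ dim Vᵢ` termwise).
Ref: Fontaine, Astérisque 223 (1994), Exposé III, Prop. 1.5.2. [folklore] -/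
theorem isAdmissible_pi_iff [∀ i, FiniteDimensional P (M i)]
    (h : ∀ (σ : Γ) (x : ∀ i, M i) (i : ι), ρ σ x i = ρs i σ (x i)) :
    𝔅.IsAdmissible ρ ↔ ∀ i, 𝔅.IsAdmissible (ρs i) := by
  have hle : ∀ i ∈ (Finset.univ : Finset ι),
      Module.finrank E (𝔅.D (ρs i)) ≤ Module.finrank P (M i) :=
    fun i _ => 𝔅.finrank_D_le_holds (ρs i)
  rw [IsAdmissible, 𝔅.finrank_D_pi ρ ρs h, Module.finrank_pi_fintype]
  simp only [IsAdmissible]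
  rw [Finset.sum_eq_sum_iff_of_le hle]
  simp

end Pi

end Closure

end PeriodRingData



/-! ## Part B: models over finite extensions and `IsCrystallineFn` -/

/-! ### Constructors for continuous representations (stated as existence theorems) -/

section Constructors

universe u v w

variable {G : Type u} [Group G] [TopologicalSpace G] {A : Type v} [CommRing A] [TopologicalSpace A]

/-- **Sub-representation** on a stable submodule (subspace topology). [folklore] -/
theorem ContinuousRep.exists_subrep {M : Type w} [AddCommGroup M] [Module A M] [TopologicalSpace M]
    (ρ : ContinuousRep G A M) (N : Submodule A M) (hN : ∀ (g : G) (x : M), x ∈ N → ρ g x ∈ N) :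
    ∃ ρN : ContinuousRep G A N, ∀ (g : G) (x : N), (ρN g x : M) = ρ g x :=
  ⟨{ toRepresentation :=
      { toFun := fun g => (ρ g : M →ₗ[A] M).restrict fun x hx => hN g x hx
        map_one' := by
          refine LinearMap.ext fun x => Subtype.ext ?_
          simp [LinearMap.restrict_apply]
        map_mul' := fun g h => by
          refine LinearMap.ext fun x => Subtype.ext ?_
          simp [LinearMap.restrict_apply] }
     continuous_smul :=
      (ρ.continuous_smul.comp (continuous_fst.prodMk
        (continuous_subtype_val.comp continuous_snd))).subtype_mk _ },
    fun _ _ => rfl⟩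

/-- **Product representation** `Π ρᵢ` on `Π Mᵢ` (componentwise action, product topology). [folklore] -/
theorem ContinuousRep.exists_pi {ι : Type} {M : ι → Type w} [∀ i, AddCommGroup (M i)]
    [∀ i, Module A (M i)] [∀ i, TopologicalSpace (M i)] (ρs : ∀ i, ContinuousRep G A (M i)) :
    ∃ ρ : ContinuousRep G A (∀ i, M i), ∀ (g : G) (x : ∀ i, M i) (i : ι), ρ g x i = ρs i g (x i) :=
  ⟨{ toRepresentation :=
      { toFun := fun g => LinearMap.pi fun i => (ρs i g : M i →ₗ[A] M i) ∘ₗ LinearMap.proj i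
        map_one' := by
          refine LinearMap.ext fun x => funext fun i => ?_
          simp
        map_mul' := fun g h => by
          refine LinearMap.ext fun x => funext fun i => ?_
          simp }
     continuous_smul := continuous_pi fun i =>
      (ρs i).continuous_smul.comp (continuous_fst.prodMk
        ((_root_.continuous_apply i).comp continuous_snd)) },
    fun _ _ _ => rfl⟩

/-- **Scalar representation by a continuous character**: for an `A`-algebra `R` (a topological
ring) and a continuous multiplicative `χ : G → R`, the `A`-linear representation `x ↦ χ(g) x` on
`R`. [folklore] -/
theorem ContinuousRep.exists_scalar {R : Type w} [CommRing R] [Algebra A R] [TopologicalSpace R]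
    [IsTopologicalRing R] (χ : G → R) (hχ : Continuous χ) (h1 : χ 1 = 1)
    (hmul : ∀ g h, χ (g * h) = χ g * χ h) :
    ∃ ρ : ContinuousRep G A R, ∀ (g : G) (x : R), ρ g x = χ g * x :=
  ⟨{ toRepresentation :=
      { toFun := fun g => LinearMap.mulLeft A (χ g)
        map_one' := by rw [h1, LinearMap.mulLeft_one]; rfl
        map_mul' := fun g h => by rw [hmul, LinearMap.mulLeft_mul]; rfl }
     continuous_smul := (hχ.comp continuous_fst).mul continuous_snd },
    fun _ _ => rfl⟩

end Constructors

/-! ### Entries in finite extensions of `ℚ_p` -/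

section Entries

variable {p : ℕ} [Fact p.Prime] {n : ℕ}

/-- The entries of finitely many matrices over `ℚ̄_p` lie in a common finite extension of `ℚ_p`
(every element of `ℚ̄_p` is algebraic). [folklore] -/
theorem exists_finiteDimensional_forall_mem_of_finite {ι : Type} [Finite ι]
    (A : ι → Matrix (Fin n) (Fin n) (PadicAlgCl p)) :
    ∃ E : IntermediateField ℚ_[p] (PadicAlgCl p), FiniteDimensional ℚ_[p] E ∧
      ∀ k i j, A k i j ∈ E := by
  let S : Set (PadicAlgCl p) := Set.range fun t : ι × Fin n × Fin n => A t.1 t.2.1 t.2.2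
  haveI : Finite S := Set.finite_range _ |>.to_subtype
  refine ⟨IntermediateField.adjoin ℚ_[p] S,
    IntermediateField.finiteDimensional_adjoin fun x _ =>
      (Algebra.IsAlgebraic.isAlgebraic x).isIntegral, fun k i j => ?_⟩
  exact IntermediateField.subset_adjoin ℚ_[p] S ⟨(k, i, j), rfl⟩

/-- The entries of `P` and `P⁻¹`, `P ∈ GL_n(ℚ̄_p)`, lie in a common finite extension of `ℚ_p`.
[folklore] -/
theorem exists_finiteDimensional_mem_entries (P : GL (Fin n) (PadicAlgCl p)) :
    ∃ E : IntermediateField ℚ_[p] (PadicAlgCl p), FiniteDimensional ℚ_[p] E ∧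
      ∀ i j, (P : Matrix (Fin n) (Fin n) (PadicAlgCl p)) i j ∈ E ∧
        ((P⁻¹ : GL (Fin n) (PadicAlgCl p)) : Matrix (Fin n) (Fin n) (PadicAlgCl p)) i j ∈ E := by
  obtain ⟨E, hE, h⟩ := exists_finiteDimensional_forall_mem_of_finite (p := p) (n := n)
    (fun b : Bool => if b then (P : Matrix (Fin n) (Fin n) (PadicAlgCl p)) else
      ((P⁻¹ : GL (Fin n) (PadicAlgCl p)) : Matrix (Fin n) (Fin n) (PadicAlgCl p)))
  exact ⟨E, hE, fun i j => ⟨by simpa using h true i j, by simpa using h false i j⟩⟩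

variable {K : Type} [Field K]

/-- **All entries of a continuous `ρ : Γ_K → GL_n(ℚ̄_p)` (and of the inverses) lie in one finite
extension `E/ℚ_p`** — from the existence of a model over a finite extension
(`Literature.NumberTheory.Automorphic.exists_hasQlModel_holds`, Baire category), enlarged by the
entries of the conjugating matrix. [folklore] -/
theorem FramedGaloisRep.exists_finiteDimensional_forall_mem
    (ρ : FramedGaloisRep K (PadicAlgCl p) n) :
    ∃ E : IntermediateField ℚ_[p] (PadicAlgCl p), FiniteDimensional ℚ_[p] E ∧
      ∀ σ i j, (ρ σ : Matrix (Fin n) (Fin n) (PadicAlgCl p)) i j ∈ E ∧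
        (((ρ σ)⁻¹ : GL (Fin n) (PadicAlgCl p)) : Matrix (Fin n) (Fin n) (PadicAlgCl p)) i j ∈ E := by
  obtain ⟨E, rE, hE, P, hP⟩ := Automorphic.exists_hasQlModel_holds ρ
  obtain ⟨E_P, hE_P, hPmem⟩ := exists_finiteDimensional_mem_entries P
  haveI := hE
  haveI := hE_P
  refine ⟨E ⊔ E_P, inferInstance, ?_⟩
  -- entries of `P (rE σ) P⁻¹` are in `E ⊔ E_P`
  have key : ∀ σ i j, (ρ σ : Matrix (Fin n) (Fin n) (PadicAlgCl p)) i j ∈ E ⊔ E_P := by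
    intro σ i j
    rw [← hP, FramedRep.conj_apply, Units.val_mul, Units.val_mul, Matrix.mul_apply]
    refine sum_mem fun l _ => mul_mem ?_ ((le_sup_right : E_P ≤ E ⊔ E_P) (hPmem l j).2)
    rw [Matrix.mul_apply]
    refine sum_mem fun m _ => mul_mem ((le_sup_right : E_P ≤ E ⊔ E_P) (hPmem i m).1) ?_
    rw [FramedRep.coe_baseChange_apply, Matrix.map_apply]
    exact (le_sup_left : E ≤ E ⊔ E_P) (SetLike.coe_mem _)
  intro σ i j
  refine ⟨key σ i j, ?_⟩
  rw [← map_inv]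
  exact key σ⁻¹ i j

end Entries

/-! ### Descent of admissibility along a finite extension of coefficients -/

section Models

universe u w

variable {p : ℕ} [Fact p.Prime] {L : Type u} [Field L] [Algebra ℚ_[p] L] {n : ℕ}

/-- The inclusion of intermediate fields `E' ≤ E''` of `ℚ̄_p` is continuous (subspace
topologies). [folklore] -/
theorem continuous_intermediateField_inclusion {E' E'' : IntermediateField ℚ_[p] (PadicAlgCl p)}
    (h : E' ≤ E'') : Continuous (IntermediateField.inclusion h) :=
  continuous_induced_rng.2 continuous_subtype_val

/-- The inclusion `E' → E'' → ℚ̄_p` is the inclusion `E' → ℚ̄_p`. [folklore] -/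
theorem algebraMap_comp_inclusion {E' E'' : IntermediateField ℚ_[p] (PadicAlgCl p)}
    (h : E' ≤ E'') :
    (algebraMap E'' (PadicAlgCl p)).comp (IntermediateField.inclusion h).toRingHom =
      algebraMap E' (PadicAlgCl p) :=
  RingHom.ext fun _ => rfl

variable (𝔅 : CrystallinePeriodRingData.{0, u, w} ℚ_[p] L)

-- Mathlib's own global value (nested instance problems on `𝔅.B ⊗[P] M`).
set_option maxSynthPendingDepth 3 in
/-- **Descent of admissibility along a finite extension of the coefficients.**  If `r` is a
continuous representation over `E'` and its extension of scalars to `E'' ⊇ E'` (finite over `ℚ_p`)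
is `B`-admissible as a `ℚ_p`-linear representation, then so is `r`: as `ℚ_p[Γ]`-modules
`E''ⁿ ≅ (E'ⁿ)^d`, `d = [E'' : E']`, and `D_B` is additive.
Ref: Fontaine, Astérisque 223 (1994), Exposé III, Prop. 1.5.2; Buzzard–Gee 2014, §2.2
(independence of the coefficient field). [folklore] -/
theorem isAdmissible_restrictScalars_of_le {E' E'' : IntermediateField ℚ_[p] (PadicAlgCl p)}
    (h : E' ≤ E'') [FiniteDimensional ℚ_[p] E''] (r : FramedGaloisRep L E' n)
    (hadm : 𝔅.toPeriodRingData.IsAdmissible (FramedRep.restrictScalars ℚ_[p]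
      (r.baseChange (IntermediateField.inclusion h).toRingHom
        (continuous_intermediateField_inclusion h)))) :
    𝔅.toPeriodRingData.IsAdmissible (FramedRep.restrictScalars ℚ_[p] r) := by
  classical
  letI : Algebra E' E'' := (IntermediateField.inclusion h).toRingHom.toAlgebra
  haveI : IsScalarTower ℚ_[p] E' E'' :=
    IsScalarTower.of_algebraMap_eq fun x => ((IntermediateField.inclusion h).commutes x).symm
  haveI : FiniteDimensional E' E'' := Module.Finite.of_restrictScalars_finite ℚ_[p] E' E''
  haveI : FiniteDimensional ℚ_[p] E' := Module.Finite.of_injective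
    (IntermediateField.inclusion h).toLinearMap (IntermediateField.inclusion h).toRingHom.injective
  set d := Module.finrank E' E'' with hd_def
  let b : Module.Basis (Fin d) E' E'' := Module.finBasis E' E''
  obtain ⟨k₀⟩ := b.index_nonempty
  -- the `ℚ_p`-linear isomorphism `(E'ⁿ)^d ≃ E''ⁿ`, `w ↦ (i ↦ Σ_k w k i • b k)`
  let e₀ : (Fin d → E') ≃ₗ[ℚ_[p]] E'' := b.equivFun.symm.restrictScalars ℚ_[p]
  let sw : (Fin d → Fin n → E') ≃ₗ[ℚ_[p]] (Fin n → Fin d → E') :=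
    { toFun := fun w i k => w k i
      invFun := fun v k i => v i k
      map_add' := fun _ _ => rfl
      map_smul' := fun _ _ => rfl
      left_inv := fun _ => rfl
      right_inv := fun _ => rfl }
  let Φ : (Fin d → Fin n → E') ≃ₗ[ℚ_[p]] (Fin n → E'') :=
    sw.trans (LinearEquiv.piCongrRight fun _ => e₀)
  have hΦ : ∀ (w : Fin d → Fin n → E') (i : Fin n), Φ w i = ∑ k, w k i • b k := fun w i => by
    change b.equivFun.symm (fun k => w k i) = _
    rw [Module.Basis.equivFun_symm_apply]
  -- the representation `(r|_{ℚ_p})^d` on `(E'ⁿ)^d`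
  obtain ⟨ρπ, hρπ⟩ := ContinuousRep.exists_pi (fun _ : Fin d => FramedRep.restrictScalars ℚ_[p] r)
  have hequiv : ∀ (σ : absoluteGaloisGroup L) (w : Fin d → Fin n → E'),
      Φ (ρπ σ w) = (FramedRep.restrictScalars ℚ_[p] (r.baseChange
        (IntermediateField.inclusion h).toRingHom (continuous_intermediateField_inclusion h))) σ
          (Φ w) := by
    intro σ w
    funext i
    rw [FramedRep.restrictScalars_apply_apply, FramedRep.coe_baseChange_apply, hΦ]
    simp only [hρπ, FramedRep.restrictScalars_apply_apply, Matrix.mulVec, dotProduct,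
      Matrix.map_apply, hΦ, Finset.mul_sum, Finset.sum_smul]
    rw [Finset.sum_comm]
    refine Finset.sum_congr rfl fun j _ => Finset.sum_congr rfl fun k _ => ?_
    rw [Algebra.smul_def, Algebra.smul_def, map_mul, mul_assoc]
    rfl
  have h1 : 𝔅.toPeriodRingData.IsAdmissible ρπ :=
    (𝔅.toPeriodRingData.isAdmissible_iff_of_equiv ρπ _ Φ hequiv).2 hadm
  exact (𝔅.toPeriodRingData.isAdmissible_pi_iff ρπ
    (fun _ : Fin d => FramedRep.restrictScalars ℚ_[p] r) hρπ).1 h1 k₀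

/-! ### Conjugation invariance of `IsCrystallineFn` -/

set_option maxSynthPendingDepth 3 in
/-- **`IsCrystallineFn` is invariant under `GL_n(ℚ̄_p)`-conjugation**: if every finite model of
`f` is crystalline then so is every finite model of `P f P⁻¹` (base-change a model of `P f P⁻¹` to
a finite extension containing the entries of `P`, conjugate back to a model of `f`, and descend).
Ref: Fontaine, Astérisque 223 (1994), Exposé III §1.5 (admissibility is a property of the
isomorphism class); BLGGT §1.4, first remark. [folklore] -/
theorem IsCrystallineFn.conj {f : absoluteGaloisGroup L → Matrix (Fin n) (Fin n) (PadicAlgCl p)}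
    (hf : IsCrystallineFn 𝔅 f) (P : GL (Fin n) (PadicAlgCl p)) :
    IsCrystallineFn 𝔅 fun σ => (P : Matrix (Fin n) (Fin n) (PadicAlgCl p)) * f σ *
      ((P⁻¹ : GL (Fin n) (PadicAlgCl p)) : Matrix (Fin n) (Fin n) (PadicAlgCl p)) := by
  intro E' hE' r' hr'
  simp only at hr'
  haveI := hE'
  obtain ⟨E_P, hE_P, hPmem⟩ := exists_finiteDimensional_mem_entries P
  haveI := hE_P
  set E'' : IntermediateField ℚ_[p] (PadicAlgCl p) := E' ⊔ E_P with hE''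
  have h1 : E' ≤ E'' := le_sup_left
  have h2 : E_P ≤ E'' := le_sup_right
  let ι : E' →+* E'' := (IntermediateField.inclusion h1).toRingHom
  have hι : Continuous ι := continuous_intermediateField_inclusion h1
  let r'' : FramedGaloisRep L E'' n := r'.baseChange ι hι
  -- `P` as an element of `GL_n(E'')`
  have hPE : ∀ i j, (P : Matrix (Fin n) (Fin n) (PadicAlgCl p)) i j ∈ E'' := fun i j =>
    h2 (hPmem i j).1
  have hPE' : ∀ i j, ((P⁻¹ : GL (Fin n) (PadicAlgCl p)) : Matrix (Fin n) (Fin n) (PadicAlgCl p))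
      i j ∈ E'' := fun i j => h2 (hPmem i j).2
  obtain ⟨hm1, hm2⟩ := Automorphic.of_entries_mul_of_entries_inv E'' P hPE hPE'
  let PE : GL (Fin n) E'' :=
    ⟨Matrix.of fun i j => ⟨(P : Matrix (Fin n) (Fin n) (PadicAlgCl p)) i j, hPE i j⟩,
      Matrix.of fun i j => ⟨((P⁻¹ : GL (Fin n) (PadicAlgCl p)) :
        Matrix (Fin n) (Fin n) (PadicAlgCl p)) i j, hPE' i j⟩, hm1, hm2⟩
  have hPE_map : (PE : Matrix (Fin n) (Fin n) E'').map (algebraMap E'' (PadicAlgCl p)) = P := by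
    ext i j; rfl
  have hPE_inv_map : ((PE⁻¹ : GL (Fin n) E'') : Matrix (Fin n) (Fin n) E'').map
      (algebraMap E'' (PadicAlgCl p)) =
        ((P⁻¹ : GL (Fin n) (PadicAlgCl p)) : Matrix (Fin n) (Fin n) (PadicAlgCl p)) := by
    ext i j; rfl
  -- the model of `f` over `E''`
  let r : FramedGaloisRep L E'' n := FramedRep.conj PE⁻¹ r''
  have hr''map : ∀ σ, (FramedRep.matrixFn r'' σ).map (algebraMap E'' (PadicAlgCl p)) =
      (P : Matrix (Fin n) (Fin n) (PadicAlgCl p)) * f σ *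
        ((P⁻¹ : GL (Fin n) (PadicAlgCl p)) : Matrix (Fin n) (Fin n) (PadicAlgCl p)) := by
    intro σ
    rw [← hr' σ, FramedRep.matrixFn_apply, FramedRep.matrixFn_apply,
      FramedRep.coe_baseChange_apply, Matrix.map_map]
    rfl
  have hr : ∀ σ, (FramedRep.matrixFn r σ).map (algebraMap E'' (PadicAlgCl p)) = f σ := by
    intro σ
    have e1 : FramedRep.matrixFn r σ = ((PE⁻¹ : GL (Fin n) E'') : Matrix (Fin n) (Fin n) E'') *
        FramedRep.matrixFn r'' σ * (PE : Matrix (Fin n) (Fin n) E'') := by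
      simp [r, FramedRep.matrixFn]
    rw [e1, Matrix.map_mul, Matrix.map_mul, hr''map, hPE_map, hPE_inv_map]
    have hu : ((P⁻¹ : GL (Fin n) (PadicAlgCl p)) : Matrix (Fin n) (Fin n) (PadicAlgCl p)) *
        (P : Matrix (Fin n) (Fin n) (PadicAlgCl p)) = 1 := by
      rw [← Units.val_mul, inv_mul_cancel, Units.val_one]
    calc _ = ((P⁻¹ : GL (Fin n) (PadicAlgCl p)) : Matrix (Fin n) (Fin n) (PadicAlgCl p)) *
          (P : Matrix (Fin n) (Fin n) (PadicAlgCl p)) * f σ *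
          (((P⁻¹ : GL (Fin n) (PadicAlgCl p)) : Matrix (Fin n) (Fin n) (PadicAlgCl p)) *
            (P : Matrix (Fin n) (Fin n) (PadicAlgCl p))) := by
            simp only [Matrix.mul_assoc]
      _ = f σ := by rw [hu, Matrix.one_mul, Matrix.mul_one]
  have hadm_r : 𝔅.toPeriodRingData.IsAdmissible (FramedRep.restrictScalars ℚ_[p] r) :=
    hf E'' inferInstance r hr
  -- `r''` is conjugate to `r`, hence admissible
  let eP : (Fin n → E'') ≃ₗ[ℚ_[p]] (Fin n → E'') :=
    { toFun := fun v => (PE : Matrix (Fin n) (Fin n) E'') *ᵥ v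
      invFun := fun v => ((PE⁻¹ : GL (Fin n) E'') : Matrix (Fin n) (Fin n) E'') *ᵥ v
      map_add' := fun v w => Matrix.mulVec_add _ v w
      map_smul' := fun c v => by
        simp only [RingHom.id_apply]
        rw [← algebraMap_smul E'' c v, Matrix.mulVec_smul, algebraMap_smul]
      left_inv := fun v => by
        change ((PE⁻¹ : GL (Fin n) E'') : Matrix (Fin n) (Fin n) E'') *ᵥ
          ((PE : Matrix (Fin n) (Fin n) E'') *ᵥ v) = v
        rw [Matrix.mulVec_mulVec, ← Units.val_mul, inv_mul_cancel, Units.val_one, Matrix.one_mulVec]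
      right_inv := fun v => by
        change (PE : Matrix (Fin n) (Fin n) E'') *ᵥ
          (((PE⁻¹ : GL (Fin n) E'') : Matrix (Fin n) (Fin n) E'') *ᵥ v) = v
        rw [Matrix.mulVec_mulVec, ← Units.val_mul, mul_inv_cancel, Units.val_one, Matrix.one_mulVec] }
  have heP : ∀ (σ : absoluteGaloisGroup L) (v : Fin n → E''),
      eP (FramedRep.restrictScalars ℚ_[p] r σ v) = FramedRep.restrictScalars ℚ_[p] r'' σ (eP v) := by
    intro σ v
    have e : ((r σ : GL (Fin n) E'') : Matrix (Fin n) (Fin n) E'') =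
        ((PE⁻¹ * r'' σ * PE : GL (Fin n) E'') : Matrix (Fin n) (Fin n) E'') := by
      simp only [r, FramedRep.conj_apply, inv_inv]
    have hu : PE * (PE⁻¹ * r'' σ * PE) = r'' σ * PE := by group
    change (PE : Matrix (Fin n) (Fin n) E'') *ᵥ (((r σ : GL (Fin n) E'') : Matrix (Fin n) (Fin n) E'') *ᵥ v) =
      ((r'' σ : GL (Fin n) E'') : Matrix (Fin n) (Fin n) E'') *ᵥ ((PE : Matrix (Fin n) (Fin n) E'') *ᵥ v)
    rw [e, Matrix.mulVec_mulVec, Matrix.mulVec_mulVec, ← Units.val_mul, ← Units.val_mul, hu]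
  have hadm_r'' : 𝔅.toPeriodRingData.IsAdmissible (FramedRep.restrictScalars ℚ_[p] r'') :=
    (𝔅.toPeriodRingData.isAdmissible_iff_of_equiv _ _ eP heP).1 hadm_r
  exact isAdmissible_restrictScalars_of_le 𝔅 h1 r' hadm_r''

/-- `IsCrystallineFn` for the matrix function of a framed representation is invariant under inner
automorphisms of the group: `ρ ∘ inn(τ) = ρ(τ) ρ ρ(τ)⁻¹`. [folklore] -/
theorem IsCrystallineFn.matrixFn_comp_conj (F : FramedGaloisRep L (PadicAlgCl p) n)
    (hF : IsCrystallineFn 𝔅 (FramedRep.matrixFn F)) (τ : absoluteGaloisGroup L) :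
    IsCrystallineFn 𝔅 (FramedRep.matrixFn F ∘ fun σ => τ * σ * τ⁻¹) := by
  have : (FramedRep.matrixFn F ∘ fun σ => τ * σ * τ⁻¹) = fun σ =>
      ((F τ : GL (Fin n) (PadicAlgCl p)) : Matrix (Fin n) (Fin n) (PadicAlgCl p)) *
        FramedRep.matrixFn F σ * (((F τ)⁻¹ : GL (Fin n) (PadicAlgCl p)) :
          Matrix (Fin n) (Fin n) (PadicAlgCl p)) := by
    funext σ
    simp only [Function.comp_apply, FramedRep.matrixFn_apply, map_mul, map_inv, Units.val_mul]
  rw [this]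
  exact hF.conj 𝔅 (F τ)

end Models


/-! ### The diagonal part of an upper-triangular crystalline representation is crystalline -/

section Diagonal

universe u w

variable {p : ℕ} [Fact p.Prime] {L : Type u} [Field L] [Algebra ℚ_[p] L] {n : ℕ}
variable (𝔅 : CrystallinePeriodRingData.{0, u, w} ℚ_[p] L)

set_option maxSynthPendingDepth 3 in
/-- **The graded pieces of an invariant complete flag of a crystalline representation are
crystalline, and so is their sum** (model level): if `F : Γ_L → GL_n(ℚ̄_p)` is upper triangular
with entries in a finite extension `E₀/ℚ_p` and every finite model of `F` is `B`-admissible, then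
every finite model of the diagonal representation `σ ↦ diag((F σ)_{11}, …, (F σ)_{nn})` is
`B`-admissible.  Proof: over `E₂ = E' E₀` the standard flag `W_k = ⟨e_0, …, e_{k-1}⟩` is stable,
the exact sequences `0 → W_k → W_{k+1} → E₂(χ_k) → 0` and Fontaine's Prop. 1.5.2
(`isAdmissible_of_shortExact`) make every `χ_k` admissible by descending induction, their product
is admissible (`isAdmissible_pi_iff`), and one descends from `E₂` to `E'`.
Ref: Fontaine, Astérisque 223 (1994), Exposé III, Prop. 1.5.2 (sub-objects, quotients, sums of
admissible representations); BLGGT §1.4 proof of Lemma 1.4.3 (1). [folklore] -/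
theorem IsCrystallineFn.diagonal_of_isUpperTriangular (F : FramedGaloisRep L (PadicAlgCl p) n)
    (hF : F.IsUpperTriangular) (E₀ : IntermediateField ℚ_[p] (PadicAlgCl p))
    [FiniteDimensional ℚ_[p] E₀]
    (hE₀ : ∀ σ i j, (F σ : Matrix (Fin n) (Fin n) (PadicAlgCl p)) i j ∈ E₀ ∧
      (((F σ)⁻¹ : GL (Fin n) (PadicAlgCl p)) : Matrix (Fin n) (Fin n) (PadicAlgCl p)) i j ∈ E₀)
    (hcr : IsCrystallineFn 𝔅 (FramedRep.matrixFn F)) :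
    IsCrystallineFn 𝔅 fun σ =>
      Matrix.diagonal fun i => (F σ : Matrix (Fin n) (Fin n) (PadicAlgCl p)) i i := by
  intro E' hE' rδ hrδ
  simp only at hrδ
  haveI := hE'
  classical
  set E₂ : IntermediateField ℚ_[p] (PadicAlgCl p) := E' ⊔ E₀ with hE₂
  have h1 : E' ≤ E₂ := le_sup_left
  have h0 : E₀ ≤ E₂ := le_sup_right
  -- the model `m` of `F` over `E₂`
  obtain ⟨m, hm⟩ := FramedRep.exists_baseChange_eq F E₂
    fun σ i j => ⟨h0 (hE₀ σ i j).1, h0 (hE₀ σ i j).2⟩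
  have hmF : ∀ σ, ((m σ : GL (Fin n) E₂) : Matrix (Fin n) (Fin n) E₂).map
      (algebraMap E₂ (PadicAlgCl p)) = (F σ : Matrix (Fin n) (Fin n) (PadicAlgCl p)) := fun σ => by
    rw [← hm]; rfl
  have hm_adm : 𝔅.toPeriodRingData.IsAdmissible (FramedRep.restrictScalars ℚ_[p] m) :=
    hcr E₂ inferInstance m hmF
  have hmU : m.IsUpperTriangular := fun σ i j hij => by
    apply (algebraMap E₂ (PadicAlgCl p)).injective
    rw [map_zero, ← hF σ i j hij, ← hmF σ, Matrix.map_apply]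
  -- the standard flag
  let W : ℕ → Submodule ℚ_[p] (Fin n → E₂) := fun k =>
    { carrier := {v | ∀ i : Fin n, k ≤ (i : ℕ) → v i = 0}
      add_mem' := fun {v w} hv hw i hi => by
        simp only [Set.mem_setOf_eq] at hv hw
        simp [hv i hi, hw i hi]
      zero_mem' := fun i _ => rfl
      smul_mem' := fun c {v} hv i hi => by
        simp only [Set.mem_setOf_eq] at hv
        simp [hv i hi] }
  have hWmem : ∀ (k : ℕ) (v : Fin n → E₂), v ∈ W k ↔ ∀ i : Fin n, k ≤ (i : ℕ) → v i = 0 :=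
    fun k v => Iff.rfl
  have hWmono : ∀ k, W k ≤ W (k + 1) := fun k v hv i hi => hv i (by omega)
  let ρV := FramedRep.restrictScalars ℚ_[p] m
  have hρV : ∀ (σ : absoluteGaloisGroup L) (v : Fin n → E₂) (i : Fin n),
      ρV σ v i = ∑ j, ((m σ : GL (Fin n) E₂) : Matrix (Fin n) (Fin n) E₂) i j * v j :=
    fun σ v i => rfl
  have hWstab : ∀ k (σ : absoluteGaloisGroup L) (v : Fin n → E₂), v ∈ W k → ρV σ v ∈ W k := by
    intro k σ v hv i hi
    rw [hρV]
    refine Finset.sum_eq_zero fun j _ => ?_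
    by_cases hj : k ≤ (j : ℕ)
    · rw [hv j hj, mul_zero]
    · rw [hmU σ i j (by simp only [Fin.lt_def]; omega), zero_mul]
  have hsub := fun k => ContinuousRep.exists_subrep ρV (W k) (hWstab k)
  choose ρW hρW using hsub
  -- the diagonal characters as `ℚ_p`-linear representations on `E₂`
  have hχ := fun k : Fin n => ContinuousRep.exists_scalar (A := ℚ_[p])
    (fun σ : absoluteGaloisGroup L => ((m σ : GL (Fin n) E₂) : Matrix (Fin n) (Fin n) E₂) k k)
    ((Units.continuous_val.comp (map_continuous m)).matrix_elem k k)
    (by simp) (fun g h => hmU.diagEntry_mul k g h)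
  choose ρχ hρχ using hχ
  -- the exact sequences `0 → W k → W (k+1) → E₂(χ_k) → 0`
  have hSES : ∀ k : Fin n, 𝔅.toPeriodRingData.IsAdmissible (ρW ((k : ℕ) + 1)) →
      𝔅.toPeriodRingData.IsAdmissible (ρW k) ∧ 𝔅.toPeriodRingData.IsAdmissible (ρχ k) := by
    intro k hk
    refine 𝔅.toPeriodRingData.isAdmissible_of_shortExact (ρW k) (ρW ((k : ℕ) + 1)) (ρχ k)
      (Submodule.inclusion (hWmono k)) ((LinearMap.proj k).comp (W ((k : ℕ) + 1)).subtype)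
      ?_ ?_ (Submodule.inclusion_injective _) ?_ ?_ hk
    · intro σ x
      apply Subtype.ext
      change (ρW k σ x : Fin n → E₂) = (ρW ((k : ℕ) + 1) σ (Submodule.inclusion (hWmono k) x) :
        Fin n → E₂)
      rw [hρW, hρW]
      rfl
    · intro σ x
      change (ρW ((k : ℕ) + 1) σ x : Fin n → E₂) k = ρχ k σ ((x : Fin n → E₂) k)
      rw [hρW, hρχ, hρV]
      rw [Finset.sum_eq_single k]
      · intro j _ hjk
        rcases lt_or_gt_of_ne hjk with hjk | hjk
        · rw [hmU σ k j hjk, zero_mul]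
        · rw [x.2 j (by simp only [Fin.lt_def] at hjk; omega), mul_zero]
      · intro h; exact absurd (Finset.mem_univ k) h
    · intro y
      refine ⟨⟨Pi.single k y, fun i hi => ?_⟩, ?_⟩
      · have : i ≠ k := fun h => by subst h; omega
        simp [this]
      · simp
    · intro y
      constructor
      · intro hy
        have hy' : (y : Fin n → E₂) ∈ W k := fun i hi => by
          rcases Nat.eq_or_lt_of_le hi with hi | hi
          · have : i = k := Fin.ext hi.symm
            subst this
            exact hy
          · exact y.2 i hi
        exact ⟨⟨y, hy'⟩, rfl⟩
      · rintro ⟨z, rfl⟩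
        exact z.2 k le_rfl
  -- `W n` is everything, hence admissible
  have htop : W n = ⊤ := by
    refine eq_top_iff.2 fun v _ i hi => ?_
    exact absurd i.2 (not_lt.2 hi)
  have hWn : 𝔅.toPeriodRingData.IsAdmissible (ρW n) := by
    refine (𝔅.toPeriodRingData.isAdmissible_iff_of_equiv (ρW n) ρV
      (LinearEquiv.ofTop (W n) htop) fun σ x => ?_).2 hm_adm
    change ((ρW n σ x : W n) : Fin n → E₂) = ρV σ x
    rw [hρW]
  -- descending induction along the flag
  have hmain : ∀ j, j ≤ n → 𝔅.toPeriodRingData.IsAdmissible (ρW (n - j)) := by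
    intro j
    induction j with
    | zero => intro _; simpa using hWn
    | succ j ih =>
        intro hj
        have h' := ih (by omega)
        let k : Fin n := ⟨n - (j + 1), by omega⟩
        have e : n - j = (k : ℕ) + 1 := by simp [k]; omega
        rw [e] at h'
        exact (hSES k h').1
  have hχadm : ∀ k : Fin n, 𝔅.toPeriodRingData.IsAdmissible (ρχ k) := by
    intro k
    have h' := hmain (n - ((k : ℕ) + 1)) (by omega)
    have e : n - (n - ((k : ℕ) + 1)) = (k : ℕ) + 1 := by omega
    rw [e] at h'
    exact (hSES k h').2
  -- the diagonal representation over `E₂` is the product of the characters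
  obtain ⟨ρpi, hρpi⟩ := ContinuousRep.exists_pi ρχ
  have hpi : 𝔅.toPeriodRingData.IsAdmissible ρpi :=
    (𝔅.toPeriodRingData.isAdmissible_pi_iff ρpi ρχ hρpi).2 hχadm
  let rδ₂ : FramedGaloisRep L E₂ n :=
    rδ.baseChange (IntermediateField.inclusion h1).toRingHom (continuous_intermediateField_inclusion h1)
  have hrδ₂ : ∀ σ, ((rδ₂ σ : GL (Fin n) E₂) : Matrix (Fin n) (Fin n) E₂) =
      Matrix.diagonal fun i => ((m σ : GL (Fin n) E₂) : Matrix (Fin n) (Fin n) E₂) i i := by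
    intro σ
    apply Matrix.map_injective (algebraMap E₂ (PadicAlgCl p)).injective
    dsimp only
    change (((rδ σ : GL (Fin n) E') : Matrix (Fin n) (Fin n) E').map
      (IntermediateField.inclusion h1).toRingHom).map (algebraMap E₂ (PadicAlgCl p)) = _
    rw [Matrix.map_map, Matrix.diagonal_map (map_zero _)]
    change (FramedRep.matrixFn rδ σ).map (algebraMap E' (PadicAlgCl p)) = _
    rw [hrδ σ]
    congr 1
    funext i
    rw [← hmF σ, Matrix.map_apply]
  have hequiv : ∀ (σ : absoluteGaloisGroup L) (v : Fin n → E₂),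
      (LinearEquiv.refl ℚ_[p] (Fin n → E₂)) (FramedRep.restrictScalars ℚ_[p] rδ₂ σ v) =
        ρpi σ ((LinearEquiv.refl ℚ_[p] (Fin n → E₂)) v) := by
    intro σ v
    rw [LinearEquiv.refl_apply, LinearEquiv.refl_apply, FramedRep.restrictScalars_apply_apply,
      hrδ₂]
    funext i
    rw [hρpi, hρχ, Matrix.mulVec_diagonal]
  have hadm₂ : 𝔅.toPeriodRingData.IsAdmissible (FramedRep.restrictScalars ℚ_[p] rδ₂) :=
    (𝔅.toPeriodRingData.isAdmissible_iff_of_equiv _ _ (LinearEquiv.refl ℚ_[p] (Fin n → E₂))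
      hequiv).2 hpi
  exact isAdmissible_restrictScalars_of_le 𝔅 h1 rδ hadm₂

end Diagonal


/-! ## Part C: the coefficient ring `𝒪_E` and the power-series ring `𝒪_E⟦t⟧` -/

section CoeffRing

variable {p : ℕ} [Fact p.Prime]

/-! ### Units, the maximal ideal, locality -/

/-- Elements of `𝒪_E` have norm at most one. [folklore] -/
theorem norm_coe_padicCoeffRing_le (E : IntermediateField ℚ_[p] (PadicAlgCl p))
    (x : padicCoeffRing E) : ‖((x : E) : PadicAlgCl p)‖ ≤ 1 :=
  (mem_padicCoeffRing_iff E x).1 x.2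

/-- An element of `𝒪_E` is a unit iff it has norm one. [folklore] -/
theorem isUnit_padicCoeffRing_iff (E : IntermediateField ℚ_[p] (PadicAlgCl p))
    (x : padicCoeffRing E) : IsUnit x ↔ ‖((x : E) : PadicAlgCl p)‖ = 1 := by
  constructor
  · rintro ⟨u, rfl⟩
    have h1 := norm_coe_padicCoeffRing_le E (u : padicCoeffRing E)
    have h2 := norm_coe_padicCoeffRing_le E (↑u⁻¹ : padicCoeffRing E)
    have h3 : ‖(((u : padicCoeffRing E) : E) : PadicAlgCl p)‖ *
        ‖(((↑u⁻¹ : padicCoeffRing E) : E) : PadicAlgCl p)‖ = 1 := by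
      have := congrArg (fun z => ‖padicCoeffRingToPadicAlgCl E z‖) u.mul_inv
      simpa only [map_mul, map_one, norm_mul, norm_one, padicCoeffRingToPadicAlgCl_apply] using this
    nlinarith [norm_nonneg (((u : padicCoeffRing E) : E) : PadicAlgCl p),
      norm_nonneg (((↑u⁻¹ : padicCoeffRing E) : E) : PadicAlgCl p)]
  · intro hx
    have hx0 : (x : E) ≠ 0 := fun h => by
      rw [h] at hx; simp at hx
    have hinv : (x : E)⁻¹ ∈ padicCoeffRing E := by
      rw [mem_padicCoeffRing_iff]
      change ‖algebraMap E (PadicAlgCl p) (x : E)⁻¹‖ ≤ 1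
      rw [map_inv₀, norm_inv]
      exact inv_le_one_of_one_le₀ hx.ge
    refine ⟨⟨x, ⟨(x : E)⁻¹, hinv⟩, Subtype.ext (mul_inv_cancel₀ hx0),
      Subtype.ext (inv_mul_cancel₀ hx0)⟩, rfl⟩

/-- An element of `𝒪_E` is a non-unit iff it has norm `< 1`. [folklore] -/
theorem mem_nonunits_padicCoeffRing_iff (E : IntermediateField ℚ_[p] (PadicAlgCl p))
    (x : padicCoeffRing E) : x ∈ nonunits (padicCoeffRing E) ↔ ‖((x : E) : PadicAlgCl p)‖ < 1 := by
  rw [mem_nonunits_iff, isUnit_padicCoeffRing_iff]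
  exact ⟨fun h => lt_of_le_of_ne (norm_coe_padicCoeffRing_le E x) h, fun h => h.ne⟩

/-- **`𝒪_E` is a local ring** (the non-units `{‖x‖ < 1}` are closed under addition, by the
ultrametric inequality). [folklore] -/
theorem isLocalRing_padicCoeffRing (E : IntermediateField ℚ_[p] (PadicAlgCl p)) :
    IsLocalRing (padicCoeffRing E) := by
  refine IsLocalRing.of_nonunits_add fun a b ha hb => ?_
  rw [mem_nonunits_padicCoeffRing_iff] at ha hb ⊢
  push_cast
  exact (IsUltrametricDist.norm_add_le_max _ _).trans_lt (max_lt ha hb)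

/-- Membership in the maximal ideal of `𝒪_E`: norm `< 1`. [folklore] -/
theorem mem_maximalIdeal_padicCoeffRing_iff (E : IntermediateField ℚ_[p] (PadicAlgCl p))
    (x : padicCoeffRing E) :
    letI := isLocalRing_padicCoeffRing E
    x ∈ IsLocalRing.maximalIdeal (padicCoeffRing E) ↔ ‖((x : E) : PadicAlgCl p)‖ < 1 := by
  letI := isLocalRing_padicCoeffRing E
  rw [IsLocalRing.mem_maximalIdeal, mem_nonunits_padicCoeffRing_iff]

/-- `‖p‖ = p⁻¹` in `ℚ̄_p`. [folklore] -/
theorem norm_natCast_padicAlgCl : ‖((p : ℕ) : PadicAlgCl p)‖ = (p : ℝ)⁻¹ := by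
  rw [← map_natCast (algebraMap ℚ_[p] (PadicAlgCl p))]
  change ‖((p : ℚ_[p]) : PadicAlgCl p)‖ = _
  rw [PadicAlgCl.norm_extends]
  exact Padic.norm_p

/-- `p ∈ 𝒪_E` has norm `p⁻¹ < 1`. [folklore] -/
theorem norm_natCast_padicAlgCl_lt_one : ‖((p : ℕ) : PadicAlgCl p)‖ < 1 := by
  rw [← map_natCast (algebraMap ℚ_[p] (PadicAlgCl p))]
  change ‖((p : ℚ_[p]) : PadicAlgCl p)‖ < 1
  rw [PadicAlgCl.norm_extends]
  exact Padic.norm_p_lt_one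

/-- Elements of norm `≤ ‖p‖^k` of `𝒪_E` lie in `p^k 𝒪_E`, hence in the `k`-th power of every
ideal containing `p`. [folklore] -/
theorem mem_pow_of_norm_le (E : IntermediateField ℚ_[p] (PadicAlgCl p)) (I : Ideal (padicCoeffRing E))
    (hp : ((p : ℕ) : padicCoeffRing E) ∈ I) (k : ℕ) (x : padicCoeffRing E)
    (hx : ‖((x : E) : PadicAlgCl p)‖ ≤ ‖((p : ℕ) : PadicAlgCl p)‖ ^ k) : x ∈ I ^ k := by
  have hp0 : ((p : ℕ) : PadicAlgCl p) ≠ 0 := by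
    exact_mod_cast (Fact.out : p.Prime).ne_zero
  have hpE : ((p : ℕ) : E) ≠ 0 := by exact_mod_cast (Fact.out : p.Prime).ne_zero
  -- `y = x / p^k` lies in `𝒪_E`
  have hy : (x : E) * ((p : ℕ) : E)⁻¹ ^ k ∈ padicCoeffRing E := by
    rw [mem_padicCoeffRing_iff]
    push_cast
    rw [norm_mul, norm_pow, norm_inv]
    rw [inv_pow, ← div_eq_mul_inv, div_le_one (pow_pos (norm_pos_iff.2 hp0) k)]
    exact hx
  have e : x = ((p : ℕ) : padicCoeffRing E) ^ k * ⟨_, hy⟩ := by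
    apply Subtype.ext
    push_cast
    rw [mul_comm, mul_assoc, ← mul_pow, inv_mul_cancel₀ hpE, one_pow, mul_one]
  rw [e]
  exact Ideal.mul_mem_right _ _ (Ideal.pow_mem_pow hp k)

/-! ### `𝒪_E` is the integral closure of `ℤ_p`: Noetherianity -/

/-- **`𝒪_E = {‖x‖ ≤ 1}` is the integral closure of `ℤ_p` in `E`**: the norm of `ℚ̄_p` is the
spectral norm, so `‖x‖ ≤ 1` iff the minimal polynomial of `x` over `ℚ_p` has coefficients in
`ℤ_p` (Mathlib `spectralValue_le_one_iff`), iff `x` is integral over `ℤ_p`.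
Ref: Serre, *Local Fields*, II §2 Prop. 3; Bosch–Güntzer–Remmert 3.2.1. [folklore] -/
theorem mem_padicCoeffRing_iff_isIntegral (E : IntermediateField ℚ_[p] (PadicAlgCl p))
    [Algebra ℤ_[p] E] [IsScalarTower ℤ_[p] ℚ_[p] E] (x : E) :
    x ∈ padicCoeffRing E ↔ IsIntegral ℤ_[p] x := by
  have hxint : IsIntegral ℚ_[p] x :=
    IntermediateField.isIntegral_iff.2 (Algebra.IsAlgebraic.isAlgebraic (x : PadicAlgCl p)).isIntegral
  have hnorm : ‖(x : PadicAlgCl p)‖ = spectralValue (minpoly ℚ_[p] x) := by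
    rw [← PadicAlgCl.spectralNorm_eq, spectralNorm,
      show (x : PadicAlgCl p) = algebraMap E (PadicAlgCl p) x from rfl,
      minpoly.algebraMap_eq (algebraMap E (PadicAlgCl p)).injective]
  rw [mem_padicCoeffRing_iff, hnorm, spectralValue_le_one_iff (minpoly.monic hxint)]
  constructor
  · intro h
    -- the minimal polynomial lifts to a monic polynomial over `ℤ_p`
    have hlifts : minpoly ℚ_[p] x ∈ Polynomial.lifts (algebraMap ℤ_[p] ℚ_[p]) := by
      rw [Polynomial.lifts_iff_coeff_lifts]
      intro k
      exact ⟨⟨(minpoly ℚ_[p] x).coeff k, h k⟩, rfl⟩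
    obtain ⟨q, hq, -, hqm⟩ := Polynomial.lifts_and_natDegree_eq_and_monic hlifts (minpoly.monic hxint)
    refine ⟨q, hqm, ?_⟩
    rw [← Polynomial.aeval_def, ← Polynomial.aeval_map_algebraMap ℚ_[p], hq, minpoly.aeval]
  · intro h k
    rw [minpoly.isIntegrallyClosed_eq_field_fractions' ℚ_[p] h, Polynomial.coeff_map]
    exact PadicInt.norm_le_one _

/-- **`𝒪_E` is Noetherian for `E/ℚ_p` finite**: it is the integral closure of the Noetherian
integrally closed domain `ℤ_p` in the finite separable extension `E` of `ℚ_p = Frac ℤ_p`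
(Mathlib `integralClosure.isNoetherianRing`).
Ref: Serre, *Local Fields*, II §2 Prop. 3. [folklore] -/
theorem isNoetherianRing_padicCoeffRing (E : IntermediateField ℚ_[p] (PadicAlgCl p))
    [FiniteDimensional ℚ_[p] E] : IsNoetherianRing (padicCoeffRing E) := by
  letI : Algebra ℤ_[p] E := ((algebraMap ℚ_[p] E).comp (algebraMap ℤ_[p] ℚ_[p])).toAlgebra
  haveI : IsScalarTower ℤ_[p] ℚ_[p] E := IsScalarTower.of_algebraMap_eq fun _ => rfl
  have heq : padicCoeffRing E = (integralClosure ℤ_[p] E).toSubring := by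
    ext x
    rw [mem_padicCoeffRing_iff_isIntegral]
    rfl
  haveI : IsNoetherianRing (integralClosure ℤ_[p] E) :=
    integralClosure.isNoetherianRing (A := ℤ_[p]) (K := ℚ_[p]) E
  exact isNoetherianRing_of_ringEquiv (integralClosure ℤ_[p] E)
    (RingEquiv.subringCongr heq).symm

/-! ### Completeness -/

/-- `E` (finite over `ℚ_p`) is complete. [folklore] -/
theorem completeSpace_intermediateField (E : IntermediateField ℚ_[p] (PadicAlgCl p))
    [FiniteDimensional ℚ_[p] E] : CompleteSpace E :=
  FiniteDimensional.complete ℚ_[p] E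

/-- `𝒪_E` (for `E/ℚ_p` finite) is complete: a closed ball in the complete space `E`. [folklore] -/
theorem completeSpace_padicCoeffRing (E : IntermediateField ℚ_[p] (PadicAlgCl p))
    [FiniteDimensional ℚ_[p] E] : CompleteSpace (padicCoeffRing E) := by
  haveI := completeSpace_intermediateField E
  have hc : IsClosed ((padicCoeffRing E : Subring E) : Set E) := by
    have : ((padicCoeffRing E : Subring E) : Set E) = Metric.closedBall 0 1 := by
      ext x
      simp [mem_padicCoeffRing_iff, ← dist_zero_right]
      rfl
    rw [this]
    exact Metric.isClosed_closedBall
  exact hc.completeSpace_coe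

/-- The ideals `{‖x‖ < ε}` of `𝒪_E` (used to show that its topology is linear). [folklore] -/
theorem exists_ideal_ball (E : IntermediateField ℚ_[p] (PadicAlgCl p)) {ε : ℝ} (hε : 0 < ε) :
    ∃ I : Ideal (padicCoeffRing E), (I : Set (padicCoeffRing E)) =
      {x : padicCoeffRing E | ‖((x : E) : PadicAlgCl p)‖ < ε} :=
  ⟨{ carrier := {x : padicCoeffRing E | ‖((x : E) : PadicAlgCl p)‖ < ε}
     add_mem' := fun {a b} ha hb => by
       simp only [Set.mem_setOf_eq, Subring.coe_add, IntermediateField.coe_add] at *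
       exact (IsUltrametricDist.norm_add_le_max _ _).trans_lt (max_lt ha hb)
     zero_mem' := by simpa using hε
     smul_mem' := fun c {x} hx => by
       simp only [Set.mem_setOf_eq, smul_eq_mul, Subring.coe_mul, IntermediateField.coe_mul,
         norm_mul] at *
       calc ‖((c : E) : PadicAlgCl p)‖ * ‖((x : E) : PadicAlgCl p)‖ ≤ 1 * ‖((x : E) : PadicAlgCl p)‖ := by
             gcongr; exact norm_coe_padicCoeffRing_le E c
         _ < ε := by rw [one_mul]; exact hx }, rfl⟩

/-- **The topology of `𝒪_E` is linear** (the balls around `0` are ideals). [folklore] -/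
theorem isLinearTopology_padicCoeffRing (E : IntermediateField ℚ_[p] (PadicAlgCl p)) :
    IsLinearTopology (padicCoeffRing E) (padicCoeffRing E) := by
  choose I hI using fun ε : {ε : ℝ // 0 < ε} => exists_ideal_ball E ε.2
  refine IsLinearTopology.mk_of_hasBasis' (padicCoeffRing E) (ι := {ε : ℝ // 0 < ε})
    (S := Ideal (padicCoeffRing E)) (p := fun _ => True) (s := I) ?_
    (fun J r m h => Ideal.mul_mem_left J r h)
  have hb := (Metric.nhds_basis_ball (x := (0 : padicCoeffRing E)))
  refine hb.to_hasBasis' (fun ε hε => ⟨⟨ε, hε⟩, trivial, fun x hx => ?_⟩) (fun ε _ => ?_)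
  · have hx' : x ∈ (I ⟨ε, hε⟩ : Set (padicCoeffRing E)) := hx
    rw [hI] at hx'
    rw [Metric.mem_ball, dist_zero_right]
    exact hx'
  · refine Filter.mem_of_superset (hb.mem_of_mem ε.2) fun x hx => ?_
    rw [Metric.mem_ball, dist_zero_right] at hx
    rw [hI]
    exact hx

/-- **`𝒪_E` is `𝔪`-adically complete** (`E/ℚ_p` finite): `𝔪` is finitely generated, so
`𝔪 ⊆ {‖x‖ ≤ c}` for some `c < 1` and `𝔪^k ⊆ {‖x‖ ≤ c^k}`; conversely `{‖x‖ ≤ ‖p‖^k} ⊆ p^k𝒪_E ⊆ 𝔪^k`,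
so the `𝔪`-adic and norm topologies agree and `𝒪_E` is norm-complete.
Ref: Serre, *Local Fields*, II §1. [folklore] -/
theorem isAdicComplete_padicCoeffRing (E : IntermediateField ℚ_[p] (PadicAlgCl p))
    [FiniteDimensional ℚ_[p] E] :
    letI := isLocalRing_padicCoeffRing E
    IsAdicComplete (IsLocalRing.maximalIdeal (padicCoeffRing E)) (padicCoeffRing E) := by
  letI := isLocalRing_padicCoeffRing E
  haveI := isNoetherianRing_padicCoeffRing E
  haveI := completeSpace_padicCoeffRing E
  set O := padicCoeffRing E
  set 𝔪 := IsLocalRing.maximalIdeal O with h𝔪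
  -- Step 1: `𝔪 ⊆ {‖x‖ ≤ c}` with `c < 1`, hence `𝔪^k ⊆ {‖x‖ ≤ c^k}`.
  obtain ⟨S, hS⟩ := (isNoetherianRing_iff_ideal_fg O).1 inferInstance 𝔪
  obtain ⟨c, hc0, hc1, hcS⟩ : ∃ c : ℝ, 0 ≤ c ∧ c < 1 ∧ ∀ s ∈ S, ‖((s : E) : PadicAlgCl p)‖ ≤ c := by
    by_cases hS0 : S = ∅
    · exact ⟨0, le_rfl, one_pos, by simp [hS0]⟩
    · obtain ⟨s₀, hs₀, hmax⟩ := S.exists_max_image (fun s => ‖((s : E) : PadicAlgCl p)‖)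
        (Finset.nonempty_iff_ne_empty.2 hS0)
      refine ⟨_, norm_nonneg _, ?_, hmax⟩
      have : s₀ ∈ 𝔪 := hS ▸ Ideal.subset_span hs₀
      exact (mem_maximalIdeal_padicCoeffRing_iff E s₀).1 this
  have hball : ∀ c' : ℝ, 0 ≤ c' → ∃ J : Ideal O, ∀ x, x ∈ J ↔ ‖((x : E) : PadicAlgCl p)‖ ≤ c' :=
    fun c' hc' =>
    ⟨{ carrier := {x : O | ‖((x : E) : PadicAlgCl p)‖ ≤ c'}
       add_mem' := fun {a b} ha hb => by
         simp only [Set.mem_setOf_eq, Subring.coe_add, IntermediateField.coe_add] at *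
         exact (IsUltrametricDist.norm_add_le_max _ _).trans (max_le ha hb)
       zero_mem' := by simpa using hc'
       smul_mem' := fun a {x} hx => by
         simp only [Set.mem_setOf_eq, smul_eq_mul, Subring.coe_mul, IntermediateField.coe_mul,
           norm_mul] at *
         calc ‖((a : E) : PadicAlgCl p)‖ * ‖((x : E) : PadicAlgCl p)‖ ≤ 1 * ‖((x : E) : PadicAlgCl p)‖ := by
               gcongr; exact norm_coe_padicCoeffRing_le E a
           _ ≤ c' := by rw [one_mul]; exact hx }, fun _ => Iff.rfl⟩
  choose J hJ using hball
  have h𝔪J : 𝔪 ≤ J c hc0 := by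
    rw [← hS]
    exact Ideal.span_le.2 fun s hs => (hJ c hc0 s).2 (hcS s hs)
  have hJmul : ∀ (a b : ℝ) (ha : 0 ≤ a) (hb : 0 ≤ b), J a ha * J b hb ≤ J (a * b) (mul_nonneg ha hb) :=
    fun a b ha hb => Ideal.mul_le.2 fun x hx y hy => (hJ _ _ _).2 <| by
      push_cast
      rw [norm_mul]
      exact mul_le_mul ((hJ _ _ _).1 hx) ((hJ _ _ _).1 hy) (norm_nonneg _) ha
  have hpow : ∀ k, 𝔪 ^ k ≤ J (c ^ k) (pow_nonneg hc0 k) := by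
    intro k
    induction k with
    | zero =>
        intro x _
        exact (hJ _ _ x).2 (by rw [pow_zero]; exact norm_coe_padicCoeffRing_le E x)
    | succ k ih =>
        intro x hx
        rw [pow_succ] at hx
        have := (Ideal.mul_mono ih h𝔪J).trans (hJmul _ _ _ _) hx
        exact (hJ _ _ x).2 (by rw [pow_succ]; exact (hJ _ _ x).1 this)
  have hnorm_pow : ∀ k x, x ∈ 𝔪 ^ k → ‖((x : E) : PadicAlgCl p)‖ ≤ c ^ k := fun k x hx =>
    (hJ _ _ _).1 (hpow k hx)
  -- Step 2: `{‖x‖ ≤ ‖p‖^k} ⊆ 𝔪^k`, so `𝔪^k` is open, hence closed.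
  have hp𝔪 : ((p : ℕ) : O) ∈ 𝔪 := by
    rw [mem_maximalIdeal_padicCoeffRing_iff]
    push_cast
    exact norm_natCast_padicAlgCl_lt_one
  have hclosed : ∀ k, IsClosed ((𝔪 ^ k : Ideal O) : Set O) := by
    intro k
    apply AddSubgroup.isClosed_of_isOpen (𝔪 ^ k).toAddSubgroup
    apply AddSubgroup.isOpen_of_mem_nhds (𝔪 ^ k).toAddSubgroup (g := 0)
    have hr : 0 < ‖((p : ℕ) : PadicAlgCl p)‖ ^ k :=
      pow_pos (norm_pos_iff.2 (by exact_mod_cast (Fact.out : p.Prime).ne_zero)) k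
    refine Filter.mem_of_superset (Metric.ball_mem_nhds (0 : O) hr) fun x hx => ?_
    rw [Metric.mem_ball, dist_zero_right] at hx
    exact mem_pow_of_norm_le E 𝔪 hp𝔪 k x hx.le
  -- Step 3: Hausdorff and precomplete.
  have hsmul : ∀ (k : ℕ) (x : O), x ∈ (𝔪 ^ k • ⊤ : Submodule O O) ↔ x ∈ 𝔪 ^ k := fun k x => by
    rw [smul_eq_mul, Ideal.mul_top]
  refine { haus' := fun x hx => ?_, prec' := fun f hf => ?_ }
  · -- Hausdorff
    have hx' : ∀ k, ‖((x : E) : PadicAlgCl p)‖ ≤ c ^ k := fun k => by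
      exact hnorm_pow k x ((hsmul k x).1 (SModEq.zero.1 (hx k)))
    have h0 : ‖((x : E) : PadicAlgCl p)‖ ≤ 0 := by
      by_contra hpos
      push Not at hpos
      obtain ⟨k, hk⟩ := exists_pow_lt_of_lt_one hpos hc1
      exact absurd (hx' k) (not_le.2 hk)
    have : ((x : E) : PadicAlgCl p) = 0 := norm_eq_zero.1 (le_antisymm h0 (norm_nonneg _))
    exact Subtype.ext (Subtype.ext (by exact_mod_cast this) : (x : E) = 0)
  · -- precomplete: `f` is Cauchy for the norm
    have hdiff : ∀ {m k}, m ≤ k → f m - f k ∈ 𝔪 ^ m := fun {m k} hmk =>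
      (hsmul m _).1 ((SModEq.sub_mem).1 (hf hmk))
    have hcauchy : CauchySeq f := by
      refine Metric.cauchySeq_iff'.2 fun ε hε => ?_
      obtain ⟨N, hN⟩ := exists_pow_lt_of_lt_one hε hc1
      refine ⟨N, fun k hk => ?_⟩
      rw [dist_eq_norm, ← norm_neg, neg_sub]
      change ‖(((f N - f k : O) : E) : PadicAlgCl p)‖ < ε
      exact (hnorm_pow N _ (hdiff hk)).trans_lt hN
    obtain ⟨Lim, hLim⟩ := cauchySeq_tendsto_of_complete hcauchy
    refine ⟨Lim, fun m => SModEq.sub_mem.2 ((hsmul m _).2 ?_)⟩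
    -- `f m - Lim` is the limit of `f m - f k ∈ 𝔪^m`, and `𝔪^m` is closed
    have ht : Filter.Tendsto (fun k => f m - f k) Filter.atTop (nhds (f m - Lim)) :=
      tendsto_const_nhds.sub hLim
    exact (hclosed m).mem_of_tendsto ht
      (Filter.eventually_atTop.2 ⟨m, fun k hk => hdiff hk⟩)

/-! ### Evaluation of power series at `p` -/

/-- **Evaluation at a topologically nilpotent element**: for `π ∈ 𝒪_E` with `‖π‖ < 1` (`E/ℚ_p`
finite) there is a ring homomorphism `ev_π : 𝒪_E⟦t⟧ → 𝒪_E` with `ev_π(C c) = c` and `ev_π(t) = π`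
(Mathlib `PowerSeries.eval₂Hom`: `𝒪_E` is complete, Hausdorff and linearly topologised).
Ref: Bourbaki, *Algèbre commutative* III §4 no. 5 (substitution in formal power series). [folklore] -/
theorem exists_powerSeries_evalHom (E : IntermediateField ℚ_[p] (PadicAlgCl p))
    [FiniteDimensional ℚ_[p] E] (π : padicCoeffRing E) (hπ : ‖((π : E) : PadicAlgCl p)‖ < 1) :
    ∃ ev : PowerSeries (padicCoeffRing E) →+* padicCoeffRing E,
      (∀ c, ev (PowerSeries.C c) = c) ∧ ev PowerSeries.X = π := by
  haveI := completeSpace_padicCoeffRing E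
  haveI := isLinearTopology_padicCoeffRing E
  have hπn : PowerSeries.HasEval π := by
    rw [PowerSeries.hasEval_def, IsTopologicallyNilpotent, Metric.tendsto_atTop]
    intro ε hε
    obtain ⟨N, hN⟩ := exists_pow_lt_of_lt_one hε hπ
    refine ⟨N, fun k hk => ?_⟩
    rw [dist_zero_right]
    change ‖(((π ^ k : padicCoeffRing E) : E) : PadicAlgCl p)‖ < ε
    push_cast
    rw [norm_pow]
    exact (pow_le_pow_of_le_one (norm_nonneg _) hπ.le hk).trans_lt hN
  refine ⟨PowerSeries.eval₂Hom (φ := RingHom.id (padicCoeffRing E)) continuous_id hπn,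
    fun c => ?_, ?_⟩
  · rw [PowerSeries.coe_eval₂Hom, PowerSeries.eval₂_C, RingHom.id_apply]
  · rw [PowerSeries.coe_eval₂Hom, PowerSeries.eval₂_X]

end CoeffRing

/-! ### Power series over a complete local ring are complete -/

section PowerSeriesComplete

open PowerSeries IsLocalRing

variable {R : Type*} [CommRing R] [IsLocalRing R]

/-- Membership in the maximal ideal of `R⟦X⟧` (`R` local): the constant coefficient is in the
maximal ideal of `R`. [folklore] -/
theorem powerSeries_mem_maximalIdeal_iff (f : R⟦X⟧) :
    f ∈ maximalIdeal R⟦X⟧ ↔ constantCoeff f ∈ maximalIdeal R := by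
  rw [mem_maximalIdeal, mem_maximalIdeal, mem_nonunits_iff, mem_nonunits_iff,
    PowerSeries.isUnit_iff_constantCoeff]

/-- Coefficients of elements of `𝔐^k`, `𝔐` the maximal ideal of `R⟦X⟧`: the `i`-th coefficient
lies in `𝔪^(k-i)`. [folklore] -/
theorem powerSeries_coeff_mem_maximalIdeal_pow {k : ℕ} {f : R⟦X⟧} (hf : f ∈ maximalIdeal R⟦X⟧ ^ k)
    (i : ℕ) : coeff i f ∈ maximalIdeal R ^ (k - i) := by
  induction k generalizing f i with
  | zero => simp
  | succ k ih =>
      rw [pow_succ] at hf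
      refine Submodule.mul_induction_on hf (fun g hg h hh => ?_) (fun x y hx hy => ?_)
      · rw [coeff_mul]
        refine sum_mem fun ab hab => ?_
        rw [Finset.HasAntidiagonal.mem_antidiagonal] at hab
        have h1 := ih hg ab.1
        have h2 : coeff ab.2 h ∈ maximalIdeal R ^ (if ab.2 = 0 then 1 else 0) := by
          split_ifs with hb
          · rw [pow_one, hb, coeff_zero_eq_constantCoeff_apply]
            exact (powerSeries_mem_maximalIdeal_iff h).1 hh
          · simp
        have h3 := Ideal.mul_mem_mul h1 h2
        rw [← pow_add] at h3
        refine Ideal.pow_le_pow_right ?_ h3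
        split_ifs with hb <;> omega
      · rw [map_add]
        exact add_mem hx hy

/-- `X` lies in the maximal ideal of `R⟦X⟧`. [folklore] -/
theorem powerSeries_X_mem_maximalIdeal : (X : R⟦X⟧) ∈ maximalIdeal R⟦X⟧ := by
  rw [powerSeries_mem_maximalIdeal_iff, constantCoeff_X]; exact zero_mem _

/-- `C` maps `𝔪^j` into `𝔐^j`. [folklore] -/
theorem powerSeries_C_mem_maximalIdeal_pow {j : ℕ} {c : R} (hc : c ∈ maximalIdeal R ^ j) :
    (C c : R⟦X⟧) ∈ maximalIdeal R⟦X⟧ ^ j := by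
  have : (maximalIdeal R).map (C (R := R)) ≤ maximalIdeal R⟦X⟧ :=
    Ideal.map_le_iff_le_comap.2 fun c hc => by
      rw [Ideal.mem_comap, powerSeries_mem_maximalIdeal_iff, constantCoeff_C]; exact hc
  exact Ideal.pow_right_mono this j (Ideal.map_pow (C (R := R)) _ j ▸ Ideal.mem_map_of_mem _ hc)

/-- Conversely, if `coeff i f ∈ 𝔪^(k-i)` for all `i < k` then `f ∈ 𝔐^k`. [folklore] -/
theorem powerSeries_mem_maximalIdeal_pow_of_coeff {k : ℕ} {f : R⟦X⟧}
    (hf : ∀ i < k, coeff i f ∈ maximalIdeal R ^ (k - i)) : f ∈ maximalIdeal R⟦X⟧ ^ k := by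
  -- split `f` into its truncation and a multiple of `X^k`
  have hX : (X : R⟦X⟧) ∈ maximalIdeal R⟦X⟧ := powerSeries_X_mem_maximalIdeal
  have hC : ∀ (j : ℕ) (c : R), c ∈ maximalIdeal R ^ j → (C c : R⟦X⟧) ∈ maximalIdeal R⟦X⟧ ^ j :=
    fun j c hc => powerSeries_C_mem_maximalIdeal_pow hc
  set g : R⟦X⟧ := PowerSeries.mk fun i => coeff (i + k) f with hg
  have hdecomp : f = (∑ i ∈ Finset.range k, C (coeff i f) * X ^ i) + X ^ k * g := by
    ext d
    rw [map_add, coeff_X_pow_mul', map_sum]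
    simp only [coeff_C_mul, coeff_X_pow, mul_ite, mul_one, mul_zero, Finset.sum_ite_eq,
      Finset.mem_range, hg, coeff_mk]
    by_cases hd : d < k
    · rw [if_pos hd, if_neg (not_le.2 hd), add_zero]
    · rw [if_neg hd, if_pos (not_lt.1 hd), zero_add, Nat.sub_add_cancel (not_lt.1 hd)]
  rw [hdecomp]
  refine add_mem (sum_mem fun i hi => ?_) (Ideal.mul_mem_right _ _ (Ideal.pow_mem_pow hX k))
  rw [Finset.mem_range] at hi
  have h1 := hC _ _ (hf i hi)
  have h2 : (X : R⟦X⟧) ^ i ∈ maximalIdeal R⟦X⟧ ^ i := Ideal.pow_mem_pow hX i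
  have h3 := Ideal.mul_mem_mul h1 h2
  rwa [← pow_add, Nat.sub_add_cancel hi.le] at h3

/-- **Power series over a complete local ring are complete for the maximal ideal**:
if `R` is `𝔪`-adically complete then `R⟦X⟧` is `𝔐 = (𝔪, X)`-adically complete (coefficientwise
convergence).  Ref: Bourbaki, *Algèbre commutative* III §2 no. 6; Matsumura, *Commutative Ring
Theory*, Ex. 8.6 / proof of Thm. 3.3. [folklore] -/
theorem powerSeries_isAdicComplete_maximalIdeal [IsAdicComplete (maximalIdeal R) R] :
    IsAdicComplete (maximalIdeal R⟦X⟧) R⟦X⟧ := by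
  have hsmul : ∀ (k : ℕ) (x : R⟦X⟧), x ∈ (maximalIdeal R⟦X⟧ ^ k • ⊤ : Submodule R⟦X⟧ R⟦X⟧) ↔
      x ∈ maximalIdeal R⟦X⟧ ^ k := fun k x => by rw [smul_eq_mul, Ideal.mul_top]
  have hsmulR : ∀ (k : ℕ) (x : R), x ∈ (maximalIdeal R ^ k • ⊤ : Submodule R R) ↔
      x ∈ maximalIdeal R ^ k := fun k x => by rw [smul_eq_mul, Ideal.mul_top]
  refine { haus' := fun f hf => ?_, prec' := fun f hf => ?_ }
  · -- Hausdorff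
    ext i
    rw [map_zero]
    refine IsHausdorff.haus (IsAdicComplete.toIsHausdorff (I := maximalIdeal R) (M := R)) _
      fun j => ?_
    rw [SModEq.zero, hsmulR]
    have h := powerSeries_coeff_mem_maximalIdeal_pow
      ((hsmul (j + i) f).1 (by simpa [SModEq.zero] using hf (j + i))) i
    rwa [Nat.add_sub_cancel] at h
  · -- precomplete
    have hdiff : ∀ {m k}, m ≤ k → ∀ i, coeff i (f m) - coeff i (f k) ∈ maximalIdeal R ^ (m - i) :=
      fun {m k} hmk i => by
        rw [← map_sub]
        exact powerSeries_coeff_mem_maximalIdeal_pow ((hsmul m _).1 (SModEq.sub_mem.1 (hf hmk))) i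
    -- coefficientwise limits
    have hlim : ∀ i, ∃ c : R, ∀ j, coeff i (f (j + i)) - c ∈ maximalIdeal R ^ j := by
      intro i
      obtain ⟨c, hc⟩ := IsPrecomplete.prec (IsAdicComplete.toIsPrecomplete (I := maximalIdeal R)
        (M := R)) (f := fun j => coeff i (f (j + i))) fun {m k} hmk => by
          rw [SModEq.sub_mem, hsmulR]
          have := hdiff (show m + i ≤ k + i by omega) i
          rwa [Nat.add_sub_cancel] at this
      exact ⟨c, fun j => (hsmulR j _).1 (SModEq.sub_mem.1 (hc j))⟩
    choose c hc using hlim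
    refine ⟨PowerSeries.mk c, fun m => SModEq.sub_mem.2 ((hsmul m _).2 ?_)⟩
    refine powerSeries_mem_maximalIdeal_pow_of_coeff fun i hi => ?_
    rw [map_sub, coeff_mk]
    have h1 := hc i (m - i)
    rw [Nat.sub_add_cancel hi.le] at h1
    exact h1

end PowerSeriesComplete


/-! ## Part D: the connecting family `t ↦ (t^{j-i} ρ_{ij})` and the proof of Lemma 1.4.3 (1) -/

section FamilyHelpers

universe u

variable {G : Type u} [Group G] [TopologicalSpace G] {F : Type*} [Field F] [TopologicalSpace F]
  [IsTopologicalRing F] {n : ℕ}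

/-- The matrix function of a conjugate: `(P ρ P⁻¹)(g) = P ρ(g) P⁻¹`. [folklore] -/
theorem FramedRep.matrixFn_conj (P : GL (Fin n) F) (ρ : FramedRep G F n) :
    FramedRep.matrixFn (FramedRep.conj P ρ) = fun g =>
      (P : Matrix (Fin n) (Fin n) F) * FramedRep.matrixFn ρ g *
        ((P⁻¹ : GL (Fin n) F) : Matrix (Fin n) (Fin n) F) := by
  funext g
  simp [FramedRep.matrixFn]

/-- The matrix function of a conjugate, pointwise: `(P ρ P⁻¹)(g) = P ρ(g) P⁻¹`. [folklore] -/
theorem FramedRep.matrixFn_conj_apply (P : GL (Fin n) F) (ρ : FramedRep G F n) (g : G) :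
    FramedRep.matrixFn (FramedRep.conj P ρ) g =
      (P : Matrix (Fin n) (Fin n) F) * FramedRep.matrixFn ρ g *
        ((P⁻¹ : GL (Fin n) F) : Matrix (Fin n) (Fin n) F) := by
  simp [FramedRep.matrixFn]

omit [TopologicalSpace F] [IsTopologicalRing F] in
/-- An invertible diagonal matrix as an element of `GL_n`. [folklore] -/
theorem exists_generalLinearGroup_diagonal (d : Fin n → F) (hd : ∀ i, d i ≠ 0) :
    ∃ D : GL (Fin n) F, (D : Matrix (Fin n) (Fin n) F) = Matrix.diagonal d ∧
      ((D⁻¹ : GL (Fin n) F) : Matrix (Fin n) (Fin n) F) = Matrix.diagonal fun i => (d i)⁻¹ :=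
  ⟨⟨Matrix.diagonal d, Matrix.diagonal fun i => (d i)⁻¹,
      by rw [Matrix.diagonal_mul_diagonal, ← Matrix.diagonal_one]; congr 1; funext i;
         exact mul_inv_cancel₀ (hd i),
      by rw [Matrix.diagonal_mul_diagonal, ← Matrix.diagonal_one]; congr 1; funext i;
         exact inv_mul_cancel₀ (hd i)⟩, rfl, rfl⟩

omit [TopologicalSpace F] [IsTopologicalRing F] in
/-- Entries of a conjugate by a diagonal matrix: `(D M D⁻¹)_{ij} = d_i M_{ij} d_j⁻¹`. [folklore] -/
theorem diagonal_conj_apply {D : GL (Fin n) F} {d : Fin n → F}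
    (hD : (D : Matrix (Fin n) (Fin n) F) = Matrix.diagonal d)
    (hD' : ((D⁻¹ : GL (Fin n) F) : Matrix (Fin n) (Fin n) F) = Matrix.diagonal fun i => (d i)⁻¹)
    (M : Matrix (Fin n) (Fin n) F) (i j : Fin n) :
    ((D : Matrix (Fin n) (Fin n) F) * M * ((D⁻¹ : GL (Fin n) F) : Matrix (Fin n) (Fin n) F)) i j =
      d i * M i j * (d j)⁻¹ := by
  rw [hD, hD', Matrix.mul_diagonal, Matrix.diagonal_mul]

omit [TopologicalSpace F] [IsTopologicalRing F] in
/-- Conjugating an upper-triangular matrix by `diag(c^{-a_i})`: an entry `x` in position `(i, j)`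
becomes `c^{-a_i} x c^{a_j} = c^{a_j - a_i} x` (the entry vanishes when `a_j < a_i`). [folklore] -/
theorem inv_pow_mul_mul_inv_eq {c : F} (hc : c ≠ 0) {x : F} {a b : ℕ} (hx : b < a → x = 0) :
    c⁻¹ ^ a * x * (c⁻¹ ^ b)⁻¹ = c ^ (b - a) * x := by
  by_cases hab : b < a
  · rw [hx hab, mul_zero, zero_mul, mul_zero]
  · obtain ⟨k, hk⟩ := Nat.exists_eq_add_of_le (not_lt.1 hab)
    rw [hk, Nat.add_sub_cancel_left, inv_pow, inv_pow, inv_inv, pow_add]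
    field_simp

omit [IsTopologicalRing F] in
/-- **The diagonal part of an upper-triangular framed representation**, as a framed
representation (its entries are the diagonal characters). [folklore] -/
theorem FramedRep.IsUpperTriangular.exists_diagonal {ρ : FramedRep G F n} (h : ρ.IsUpperTriangular) :
    ∃ δ : FramedRep G F n, ∀ g, ((δ g : GL (Fin n) F) : Matrix (Fin n) (Fin n) F) =
      Matrix.diagonal fun i => (ρ g : Matrix (Fin n) (Fin n) F) i i := by
  have hcont : Continuous fun g => Matrix.diagonal fun i => (ρ g : Matrix (Fin n) (Fin n) F) i i :=
    Continuous.matrix_diagonal (continuous_pi fun i => ρ.continuous_diagEntry i)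
  refine ⟨{ toFun := fun g => ⟨Matrix.diagonal fun i => (ρ g : Matrix (Fin n) (Fin n) F) i i,
              Matrix.diagonal fun i => (ρ g⁻¹ : Matrix (Fin n) (Fin n) F) i i, ?_, ?_⟩
            map_one' := ?_
            map_mul' := ?_
            continuous_toFun := ?_ }, fun g => rfl⟩
  · rw [Matrix.diagonal_mul_diagonal, ← Matrix.diagonal_one]
    congr 1; funext i
    rw [← FramedRep.diagEntry_apply, ← FramedRep.diagEntry_apply, ← h.diagEntry_mul, mul_inv_cancel,
      FramedRep.diagEntry_one]
  · rw [Matrix.diagonal_mul_diagonal, ← Matrix.diagonal_one]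
    congr 1; funext i
    rw [← FramedRep.diagEntry_apply, ← FramedRep.diagEntry_apply, ← h.diagEntry_mul, inv_mul_cancel,
      FramedRep.diagEntry_one]
  · apply Units.ext
    change (Matrix.diagonal fun i => ((ρ 1 : GL (Fin n) F) : Matrix (Fin n) (Fin n) F) i i) = 1
    rw [map_one, Units.val_one, ← Matrix.diagonal_one]
    congr 1; funext i; exact Matrix.one_apply_eq i
  · intro a b
    apply Units.ext
    change (Matrix.diagonal fun i => ((ρ (a * b) : GL (Fin n) F) : Matrix (Fin n) (Fin n) F) i i) =
      (Matrix.diagonal fun i => ((ρ a : GL (Fin n) F) : Matrix (Fin n) (Fin n) F) i i) *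
        Matrix.diagonal fun i => ((ρ b : GL (Fin n) F) : Matrix (Fin n) (Fin n) F) i i
    rw [Matrix.diagonal_mul_diagonal]
    congr 1; funext i
    exact h.diagEntry_mul i a b
  · refine Units.continuous_iff.2 ⟨hcont, ?_⟩
    have e : (fun g => Matrix.diagonal fun i => ((ρ g⁻¹ : GL (Fin n) F) : Matrix (Fin n) (Fin n) F) i i) =
        fun g => Matrix.diagonal fun i => (((ρ g)⁻¹ : GL (Fin n) F) : Matrix (Fin n) (Fin n) F) i i := by
      funext g; rw [map_inv]
    change Continuous fun g => Matrix.diagonal fun i =>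
      ((ρ g⁻¹ : GL (Fin n) F) : Matrix (Fin n) (Fin n) F) i i
    rw [e]
    exact Continuous.matrix_diagonal (continuous_pi fun i =>
      (Units.continuous_coe_inv.comp (map_continuous ρ)).matrix_elem i i)

end FamilyHelpers

section AbsGaloisSelf

/-- **The restriction map `Γ_{K'} → Γ_{K'}` along the identity `K' ≤ K'` is an inner automorphism**
(the chosen embedding `K̄' → K̄'` is an automorphism `τ`, and restriction along it is conjugation
by `τ`): the case `ι' = id` of `absGaloisRestrict_isConj_of_algHom_holds`.
Ref: Milne, *Fields and Galois Theory*, Ch. 7, footnote to the definition of the absolute Galois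
group. [folklore] -/
theorem absGaloisRestrict_self_eq_conj {K : Type} [Field K] (K' : IntermediateField K (AlgebraicClosure K))
    (hle : K' ≤ K') :
    letI : Algebra K' K' := (IntermediateField.inclusion hle).toRingHom.toAlgebra
    ∃ τ : absoluteGaloisGroup K', ∀ σ, absGaloisRestrict K' K' σ = τ * σ * τ⁻¹ := by
  letI : Algebra K' K' := (IntermediateField.inclusion hle).toRingHom.toAlgebra
  obtain ⟨τ, hτ⟩ := absGaloisRestrict_isConj_of_algHom_holds K' K'
    (AlgHom.id K' (AlgebraicClosure K')) id (fun σ x => rfl)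
  refine ⟨τ⁻¹, fun σ => ?_⟩
  have h := hτ σ
  simp only [id] at h
  rw [inv_inv]
  calc absGaloisRestrict K' K' σ = τ⁻¹ * (τ * absGaloisRestrict K' K' σ * τ⁻¹) * τ := by group
    _ = τ⁻¹ * σ * τ := by rw [← h]

end AbsGaloisSelf

section Family

open PowerSeries IsLocalRing

universe w

variable {p : ℕ} [Fact p.Prime] {n : ℕ}

/-- The product formula for the entries of the family matrices `(t^{j-i} a_{ij})`:
`t^{j-i} a · t^{k-j} b = t^{k-i} (a b)` when `a = 0` for `j < i` and `b = 0` for `k < j`. [folklore] -/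
theorem X_pow_mul_C_mul_X_pow_mul_C {R : Type*} [CommRing R] {i j k : ℕ} {a b : R}
    (ha : j < i → a = 0) (hb : k < j → b = 0) :
    (X : R⟦X⟧) ^ (j - i) * C a * (X ^ (k - j) * C b) = X ^ (k - i) * C (a * b) := by
  by_cases hij : j < i
  · rw [ha hij, map_zero, zero_mul, mul_zero, zero_mul, map_zero, mul_zero]
  by_cases hjk : k < j
  · rw [hb hjk, map_zero, mul_zero, mul_zero, mul_zero, map_zero, mul_zero]
  have e : (X : R⟦X⟧) ^ (j - i) * X ^ (k - j) = X ^ (k - i) := by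
    rw [← pow_add]; congr 1; omega
  rw [map_mul, ← e]; ring


/-- **Integral matrices.**  An upper-triangular `F : Γ → GL_n(ℚ̄_p)` with entries in `E₀` of norm
`≤ 1` is a multiplicative matrix-valued function with values in `M_n(𝒪_{E₀})`. [folklore] -/
theorem exists_integralMatrices {G : Type} [Group G] [TopologicalSpace G]
    (F : FramedRep G (PadicAlgCl p) n) (hU : F.IsUpperTriangular)
    (E₀ : IntermediateField ℚ_[p] (PadicAlgCl p))
    (hE₀ : ∀ σ i j, (F σ : Matrix (Fin n) (Fin n) (PadicAlgCl p)) i j ∈ E₀)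
    (hint : ∀ σ i j, ‖(F σ : Matrix (Fin n) (Fin n) (PadicAlgCl p)) i j‖ ≤ 1) :
    ∃ Mx : G → Matrix (Fin n) (Fin n) (padicCoeffRing E₀),
      (∀ σ i j, padicCoeffRingToPadicAlgCl E₀ (Mx σ i j) =
        (F σ : Matrix (Fin n) (Fin n) (PadicAlgCl p)) i j) ∧
      (∀ σ τ, Mx (σ * τ) = Mx σ * Mx τ) ∧ Mx 1 = 1 ∧ ∀ σ i j, j < i → Mx σ i j = 0 := by
  let ι : padicCoeffRing E₀ →+* PadicAlgCl p := padicCoeffRingToPadicAlgCl E₀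
  have hι : Function.Injective ι :=
    (algebraMap E₀ (PadicAlgCl p)).injective.comp Subtype.val_injective
  let Mx : G → Matrix (Fin n) (Fin n) (padicCoeffRing E₀) := fun σ => Matrix.of fun i j =>
    ⟨⟨(F σ : Matrix (Fin n) (Fin n) (PadicAlgCl p)) i j, hE₀ σ i j⟩, by
      rw [mem_padicCoeffRing_iff]; exact hint σ i j⟩
  have hMx : ∀ σ i j, ι (Mx σ i j) = (F σ : Matrix (Fin n) (Fin n) (PadicAlgCl p)) i j :=
    fun _ _ _ => rfl
  refine ⟨Mx, hMx, fun σ τ => ?_, ?_, fun σ i j h => hι (by rw [hMx, map_zero]; exact hU σ i j h)⟩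
  · refine Matrix.ext fun i k => hι ?_
    rw [hMx, map_mul, Units.val_mul, Matrix.mul_apply, Matrix.mul_apply, map_sum ι]
    simp only [map_mul, hMx]
  · refine Matrix.ext fun i j => hι ?_
    rw [hMx, map_one, Units.val_one, Matrix.one_apply, Matrix.one_apply]
    split_ifs <;> simp

/-- **The family `ρ_t(σ)_{ij} = t^{j-i} M(σ)_{ij}` is a representation** `Γ → GL_n(O⟦t⟧)` for a
multiplicative upper-triangular `M : Γ → M_n(O)` (formally `ρ_t = h M h⁻¹`, `h = diag(t^{-i})`).
[cite: BarnetlambEtAl2014, §1.3 proof of (dia)] -/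
theorem exists_familyRep {G : Type*} [Group G] {O : Type*} [CommRing O]
    (Mx : G → Matrix (Fin n) (Fin n) O) (hmul : ∀ σ τ, Mx (σ * τ) = Mx σ * Mx τ) (hone : Mx 1 = 1)
    (hupper : ∀ σ i j, j < i → Mx σ i j = 0) :
    ∃ rep : G →* GL (Fin n) O⟦X⟧, ∀ (σ : G) (i j : Fin n),
      ((rep σ : GL (Fin n) O⟦X⟧) : Matrix (Fin n) (Fin n) O⟦X⟧) i j =
        X ^ ((j : ℕ) - (i : ℕ)) * C (Mx σ i j) := by
  let R : G → Matrix (Fin n) (Fin n) O⟦X⟧ := fun σ =>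
    Matrix.of fun (i j : Fin n) => X ^ ((j : ℕ) - (i : ℕ)) * C (Mx σ i j)
  have hR : ∀ (σ) (i j : Fin n), R σ i j = X ^ ((j : ℕ) - (i : ℕ)) * C (Mx σ i j) :=
    fun _ _ _ => rfl
  have hR_mul : ∀ σ τ, R (σ * τ) = R σ * R τ := by
    intro σ τ
    refine Matrix.ext fun i k => ?_
    rw [Matrix.mul_apply, hR, hmul, Matrix.mul_apply, map_sum (C (R := O)), Finset.mul_sum]
    refine Finset.sum_congr rfl fun j _ => ?_
    rw [hR, hR, X_pow_mul_C_mul_X_pow_mul_C (hupper σ i j) (hupper τ j k)]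
  have hR_one : R 1 = 1 := by
    refine Matrix.ext fun i j => ?_
    rw [hR, hone, Matrix.one_apply, Matrix.one_apply]
    split_ifs with h
    · subst h; simp
    · simp
  refine ⟨{ toFun := fun σ => ⟨R σ, R σ⁻¹, by rw [← hR_mul, mul_inv_cancel, hR_one],
      by rw [← hR_mul, inv_mul_cancel, hR_one]⟩
            map_one' := Units.ext hR_one
            map_mul' := fun σ τ => Units.ext (hR_mul σ τ) }, fun σ i j => rfl⟩

/-- **Continuity of the family**: the congruence kernels `{σ | ρ_t(σ) ≡ 1 mod 𝔐^k}` are open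
(they are subgroups containing `{σ | ‖F(σ) - 1‖ < ‖p‖^k}`). [folklore] -/
theorem isOpen_setOf_congr_family {G : Type} [Group G] [TopologicalSpace G] [IsTopologicalGroup G]
    (F : FramedRep G (PadicAlgCl p) n) (E₀ : IntermediateField ℚ_[p] (PadicAlgCl p))
    (Mx : G → Matrix (Fin n) (Fin n) (padicCoeffRing E₀))
    (hMx : ∀ σ i j, padicCoeffRingToPadicAlgCl E₀ (Mx σ i j) =
      (F σ : Matrix (Fin n) (Fin n) (PadicAlgCl p)) i j)
    (rep : G →* GL (Fin n) (padicCoeffRing E₀)⟦X⟧)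
    (hrep : ∀ (σ : G) (i j : Fin n),
      ((rep σ : GL (Fin n) (padicCoeffRing E₀)⟦X⟧) : Matrix (Fin n) (Fin n) (padicCoeffRing E₀)⟦X⟧) i j =
        X ^ ((j : ℕ) - (i : ℕ)) * C (Mx σ i j)) (k : ℕ) :
    letI := isLocalRing_padicCoeffRing E₀
    IsOpen {σ : G | ∀ i j, (((rep σ : GL (Fin n) (padicCoeffRing E₀)⟦X⟧) :
      Matrix (Fin n) (Fin n) (padicCoeffRing E₀)⟦X⟧) - 1) i j ∈
        maximalIdeal (padicCoeffRing E₀)⟦X⟧ ^ k} := by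
  letI := isLocalRing_padicCoeffRing E₀
  have hp𝔪 : ((p : ℕ) : padicCoeffRing E₀) ∈ maximalIdeal (padicCoeffRing E₀) := by
    rw [mem_maximalIdeal_padicCoeffRing_iff]
    push_cast
    exact norm_natCast_padicAlgCl_lt_one
  have hpn : 0 < ‖((p : ℕ) : PadicAlgCl p)‖ :=
    norm_pos_iff.2 (by exact_mod_cast (Fact.out : p.Prime).ne_zero)
  have hentry : ∀ i j, Continuous fun σ : G => (F σ : Matrix (Fin n) (Fin n) (PadicAlgCl p)) i j :=
    fun i j => (Units.continuous_val.comp (map_continuous F)).matrix_elem i j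
  let πk := Ideal.Quotient.mk (maximalIdeal (padicCoeffRing E₀)⟦X⟧ ^ k)
  let φ : G →* GL (Fin n) ((padicCoeffRing E₀)⟦X⟧ ⧸ maximalIdeal (padicCoeffRing E₀)⟦X⟧ ^ k) :=
    (Matrix.GeneralLinearGroup.map πk).comp rep
  have hS : {σ : G | ∀ i j, (((rep σ : GL (Fin n) (padicCoeffRing E₀)⟦X⟧) : Matrix (Fin n) (Fin n) (padicCoeffRing E₀)⟦X⟧) - 1) i j ∈
      maximalIdeal (padicCoeffRing E₀)⟦X⟧ ^ k} = (φ.ker : Set G) := by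
    ext σ
    simp only [Set.mem_setOf_eq, SetLike.mem_coe, MonoidHom.mem_ker, Matrix.sub_apply]
    rw [← Units.val_eq_one]
    change _ ↔ ((rep σ : GL (Fin n) (padicCoeffRing E₀)⟦X⟧) : Matrix (Fin n) (Fin n) (padicCoeffRing E₀)⟦X⟧).map πk = 1
    rw [← Matrix.map_one πk (map_zero πk) (map_one πk), ← Matrix.ext_iff]
    simp only [Matrix.map_apply, Ideal.Quotient.eq, πk]
  rw [hS]
  apply Subgroup.isOpen_of_mem_nhds _ (g := 1)
  -- the open neighbourhood `V = {‖F σ - 1‖ < ‖p‖^k}` of `1` is contained in the kernel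
  let V : Set G := {σ | ∀ i j, ‖(F σ : Matrix (Fin n) (Fin n) (PadicAlgCl p)) i j -
      (1 : Matrix (Fin n) (Fin n) (PadicAlgCl p)) i j‖ < ‖((p : ℕ) : PadicAlgCl p)‖ ^ k}
  have hVopen : IsOpen V := by
    have : V = ⋂ i, ⋂ j, {σ | ‖(F σ : Matrix (Fin n) (Fin n) (PadicAlgCl p)) i j -
        (1 : Matrix (Fin n) (Fin n) (PadicAlgCl p)) i j‖ < ‖((p : ℕ) : PadicAlgCl p)‖ ^ k} := by
      ext σ; simp [V]
    rw [this]
    exact isOpen_iInter_of_finite fun i => isOpen_iInter_of_finite fun j =>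
      isOpen_lt ((hentry i j).sub continuous_const).norm continuous_const
  have hV1 : (1 : G) ∈ V := fun i j => by
    simp only [map_one, Units.val_one, sub_self, norm_zero]
    exact pow_pos hpn k
  refine Filter.mem_of_superset (hVopen.mem_nhds hV1) fun σ hσ => ?_
  rw [← hS]
  intro i j
  rw [Matrix.sub_apply, hrep]
  have hm : Mx σ i j - (1 : Matrix (Fin n) (Fin n) (padicCoeffRing E₀)) i j ∈ maximalIdeal (padicCoeffRing E₀) ^ k := by
    refine mem_pow_of_norm_le E₀ _ hp𝔪 k _ ?_
    have e : padicCoeffRingToPadicAlgCl E₀ (Mx σ i j - (1 : Matrix (Fin n) (Fin n) (padicCoeffRing E₀)) i j) =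
        (F σ : Matrix (Fin n) (Fin n) (PadicAlgCl p)) i j -
          (1 : Matrix (Fin n) (Fin n) (PadicAlgCl p)) i j := by
      rw [map_sub, hMx, Matrix.one_apply, Matrix.one_apply]
      split_ifs <;> simp
    rw [padicCoeffRingToPadicAlgCl_apply] at e
    rw [e]
    exact (hσ i j).le
  by_cases hij : i = j
  · subst hij
    rw [Matrix.one_apply_eq, Nat.sub_self, pow_zero, one_mul]
    have : (C (Mx σ i i) : (padicCoeffRing E₀)⟦X⟧) - 1 = C (Mx σ i i - (1 : Matrix (Fin n) (Fin n) (padicCoeffRing E₀)) i i) := by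
      rw [Matrix.one_apply_eq, map_sub, map_one]
    rw [this]
    exact powerSeries_C_mem_maximalIdeal_pow hm
  · rw [Matrix.one_apply_ne hij, sub_zero]
    rw [Matrix.one_apply_ne hij, sub_zero] at hm
    exact Ideal.mul_mem_left _ _ (powerSeries_C_mem_maximalIdeal_pow hm)

set_option maxSynthPendingDepth 3 in
set_option maxHeartbeats 800000 in
/-- **The connecting family of BLGGT §1.4, item (semisimp), for an integral upper-triangular
representation** (tree rendering).  Let `F : Γ_L → GL_n(𝒪_{E₀}) ⊆ GL_n(ℚ̄_p)` be continuous and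
upper triangular, with `E₀/ℚ_p` finite and every finite model of `F` crystalline.  Over the
complete noetherian local domain `A = 𝒪_{E₀}⟦t⟧` (residue field `k_{E₀}`) the matrices
`ρ_t(σ)_{ij} = t^{j-i} F(σ)_{ij}` (`= h F h⁻¹`, `h = diag(t^{-i})`, the printed `h e_i = t^i e_i` up
to relabelling) form a continuous representation; its specialisation at the `𝒪_{E₀}`-point
`t ↦ p` is `D_p F D_p⁻¹`, `D_p = diag(p^{-i})`, at `t ↦ 0` it is `⊕ gr^i F = diag(F_{11}, …, F_{nn})`,
and at any `ℚ̄_p`-point `t ↦ c` it is a `GL_n(ℚ̄_p)`-conjugate of `F` (`c ≠ 0`) or `⊕ gr^i F`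
(`c = 0`), hence crystalline (sub-quotients and sums of crystalline representations are
crystalline, `IsCrystallineFn.diagonal_of_isUpperTriangular`; conjugation invariance,
`IsCrystallineFn.conj`), also after composition with any inner automorphism of `Γ_L`.
Ref: BLGGT, arXiv:1010.2561, §1.3 proof sketch of (dia) (p. 12 l. 61 – p. 13 l. 1) and §1.4 item
(semisimp) (p. 14 l. 37). [cite: BarnetlambEtAl2014, §1.4 (semisimp) and §1.3 proof of (dia)] -/
theorem exists_connectingFamily_of_integral {L : Type} [Field L] [Algebra ℚ_[p] L]
    (𝔅₁ : CrystallinePeriodRingData.{0, 0, w} ℚ_[p] L) (F : FramedGaloisRep L (PadicAlgCl p) n)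
    (hU : F.IsUpperTriangular) (E₀ : IntermediateField ℚ_[p] (PadicAlgCl p))
    [FiniteDimensional ℚ_[p] E₀]
    (hE₀ : ∀ σ i j, (F σ : Matrix (Fin n) (Fin n) (PadicAlgCl p)) i j ∈ E₀ ∧
      (((F σ)⁻¹ : GL (Fin n) (PadicAlgCl p)) : Matrix (Fin n) (Fin n) (PadicAlgCl p)) i j ∈ E₀)
    (hint : ∀ σ i j, ‖(F σ : Matrix (Fin n) (Fin n) (PadicAlgCl p)) i j‖ ≤ 1)
    (hcr : IsCrystallineFn 𝔅₁ (FramedRep.matrixFn F)) :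
    ∃ (𝓕 : ConnectingFamily p (absoluteGaloisGroup L) n) (δ : FramedGaloisRep L (PadicAlgCl p) n)
      (Dp : GL (Fin n) (PadicAlgCl p)),
      (∀ σ i j, i ≠ j → FramedRep.matrixFn δ σ i j = 0) ∧
      IsCrystallineFn 𝔅₁ (FramedRep.matrixFn δ) ∧
      (Dp : Matrix (Fin n) (Fin n) (PadicAlgCl p)) =
        Matrix.diagonal (fun i : Fin n => ((p : ℕ) : PadicAlgCl p)⁻¹ ^ (i : ℕ)) ∧
      𝓕.leftFn = FramedRep.matrixFn (FramedRep.conj Dp F) ∧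
      𝓕.rightFn = FramedRep.matrixFn (FramedRep.conj 1 δ) ∧
      𝓕.PointsSatisfy fun f => ∀ τ : absoluteGaloisGroup L,
        IsCrystallineFn 𝔅₁ (f ∘ fun σ => τ * σ * τ⁻¹) := by
  classical
  haveI : IsLocalRing (padicCoeffRing E₀) := isLocalRing_padicCoeffRing E₀
  haveI : IsNoetherianRing (padicCoeffRing E₀) := isNoetherianRing_padicCoeffRing E₀
  haveI : IsAdicComplete (maximalIdeal (padicCoeffRing E₀)) (padicCoeffRing E₀) :=
    isAdicComplete_padicCoeffRing E₀
  haveI : IsAdicComplete (maximalIdeal (padicCoeffRing E₀)⟦X⟧) (padicCoeffRing E₀)⟦X⟧ :=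
    powerSeries_isAdicComplete_maximalIdeal
  have hι_apply : ∀ x : padicCoeffRing E₀, padicCoeffRingToPadicAlgCl E₀ x = ((x : E₀) : PadicAlgCl p) :=
    fun _ => rfl
  -- integral matrices, the family representation, continuity
  obtain ⟨Mx, hMx, hMx_mul, hMx_one, hMx_upper⟩ :=
    exists_integralMatrices F hU E₀ (fun σ i j => (hE₀ σ i j).1) hint
  obtain ⟨rep, hrep⟩ := exists_familyRep Mx hMx_mul hMx_one hMx_upper
  have hopen := isOpen_setOf_congr_family F E₀ Mx hMx rep hrep
  -- residue field
  have hres : Function.Surjective ((IsLocalRing.residue (padicCoeffRing E₀)⟦X⟧).comp (C (R := padicCoeffRing E₀))) := by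
    intro q
    obtain ⟨f, rfl⟩ := IsLocalRing.residue_surjective q
    refine ⟨constantCoeff f, ?_⟩
    rw [RingHom.comp_apply]
    apply Ideal.Quotient.eq.2
    rw [powerSeries_mem_maximalIdeal_iff, map_sub, constantCoeff_C, sub_self]
    exact zero_mem _
  -- evaluation at `p`
  have hpn : ((p : ℕ) : PadicAlgCl p) ≠ 0 := by exact_mod_cast (Fact.out : p.Prime).ne_zero
  have hpO : ‖((((p : ℕ) : padicCoeffRing E₀) : E₀) : PadicAlgCl p)‖ < 1 := by
    push_cast; exact norm_natCast_padicAlgCl_lt_one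
  obtain ⟨ev, hevC, hevX⟩ := exists_powerSeries_evalHom E₀ ((p : ℕ) : padicCoeffRing E₀) hpO
  -- the family
  let 𝓕 : ConnectingFamily p (absoluteGaloisGroup L) n :=
    { E := E₀
      finiteDimensional := inferInstance
      A := (padicCoeffRing E₀)⟦X⟧
      structureMap := C
      residue_comp_surjective := hres
      rep := rep
      isOpen_setOf_congr := hopen
      left := ev
      right := constantCoeff
      left_comp := RingHom.ext hevC
      right_comp := RingHom.ext fun c => constantCoeff_C c }
  -- the diagonal representation and the conjugator `D_p = diag(p^{-i})`
  obtain ⟨δ, hδ⟩ := hU.exists_diagonal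
  have hδfn : FramedRep.matrixFn δ = fun σ =>
      Matrix.diagonal fun i => (F σ : Matrix (Fin n) (Fin n) (PadicAlgCl p)) i i := funext hδ
  have hδcr : IsCrystallineFn 𝔅₁ (FramedRep.matrixFn δ) := by
    rw [hδfn]
    exact IsCrystallineFn.diagonal_of_isUpperTriangular 𝔅₁ F hU E₀ hE₀ hcr
  obtain ⟨Dp, hDp, hDp'⟩ := exists_generalLinearGroup_diagonal
    (fun i : Fin n => ((p : ℕ) : PadicAlgCl p)⁻¹ ^ (i : ℕ)) fun i => pow_ne_zero _ (inv_ne_zero hpn)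
  -- specialisations of the family
  have hspec : ∀ (y : (padicCoeffRing E₀)⟦X⟧ →+* PadicAlgCl p),
      y.comp C = padicCoeffRingToPadicAlgCl E₀ → ∀ (σ) (i j : Fin n), 𝓕.specialize y σ i j = y X ^ ((j : ℕ) - (i : ℕ)) *
        (F σ : Matrix (Fin n) (Fin n) (PadicAlgCl p)) i j := by
    intro y hy σ i j
    change (((rep σ : GL (Fin n) (padicCoeffRing E₀)⟦X⟧) :
      Matrix (Fin n) (Fin n) (padicCoeffRing E₀)⟦X⟧).map y) i j = _
    rw [Matrix.map_apply, hrep, map_mul, map_pow, ← hMx σ i j, ← hy]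
    rfl
  -- the diagonal specialisation
  have hdiag_spec : ∀ (σ) (i j : Fin n), (0 : PadicAlgCl p) ^ ((j : ℕ) - (i : ℕ)) *
      (F σ : Matrix (Fin n) (Fin n) (PadicAlgCl p)) i j = FramedRep.matrixFn δ σ i j := by
    intro σ i j
    rw [FramedRep.matrixFn_apply, hδ]
    by_cases hij : i = j
    · subst hij
      rw [Matrix.diagonal_apply_eq, Nat.sub_self, pow_zero, one_mul]
    · rw [Matrix.diagonal_apply_ne _ hij]
      rcases lt_or_gt_of_ne hij with h | h
      · rw [zero_pow (Nat.sub_ne_zero_of_lt h), zero_mul]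
      · rw [hU σ i j h, mul_zero]
  refine ⟨𝓕, δ, Dp, fun σ i j hij => ?_, hδcr, hDp, ?_, ?_, ?_⟩
  · rw [FramedRep.matrixFn_apply, hδ]; exact Matrix.diagonal_apply_ne _ hij
  · -- left endpoint: `t ↦ p`
    funext σ
    refine Matrix.ext fun i j => ?_
    change 𝓕.specialize ((padicCoeffRingToPadicAlgCl E₀).comp ev) σ i j = _
    rw [hspec ((padicCoeffRingToPadicAlgCl E₀).comp ev) (by ext c; simp [hevC]), RingHom.comp_apply, hevX,
      FramedRep.matrixFn_conj_apply, diagonal_conj_apply hDp hDp', FramedRep.matrixFn_apply,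
      inv_pow_mul_mul_inv_eq hpn (hU σ i j), hι_apply]
    push_cast
    rfl
  · -- right endpoint: `t ↦ 0`
    funext σ
    refine Matrix.ext fun i j => ?_
    change 𝓕.specialize ((padicCoeffRingToPadicAlgCl E₀).comp constantCoeff) σ i j = _
    rw [hspec ((padicCoeffRingToPadicAlgCl E₀).comp constantCoeff) (by ext c; simp), RingHom.comp_apply,
      constantCoeff_X, map_zero, hdiag_spec, FramedRep.matrixFn_conj_apply]
    simp only [Units.val_one, inv_one, Matrix.one_mul, Matrix.mul_one]
  · -- every point is crystalline, also after an inner automorphism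
    intro y hy τ
    change y.comp C = padicCoeffRingToPadicAlgCl E₀ at hy
    by_cases hc : y X = 0
    · have e : 𝓕.specialize y = FramedRep.matrixFn δ := by
        funext σ; refine Matrix.ext fun i j => ?_
        rw [hspec y hy, hc, hdiag_spec]
      rw [e]
      exact hδcr.matrixFn_comp_conj 𝔅₁ δ τ
    · obtain ⟨D, hD, hD'⟩ := exists_generalLinearGroup_diagonal
        (fun i : Fin n => (y X)⁻¹ ^ (i : ℕ)) fun i => pow_ne_zero _ (inv_ne_zero hc)
      have e : 𝓕.specialize y = FramedRep.matrixFn (FramedRep.conj D F) := by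
        funext σ; refine Matrix.ext fun i j => ?_
        rw [hspec y hy, FramedRep.matrixFn_conj_apply, diagonal_conj_apply hD hD',
          FramedRep.matrixFn_apply, inv_pow_mul_mul_inv_eq hc (hU σ i j)]
      rw [e]
      refine IsCrystallineFn.matrixFn_comp_conj 𝔅₁ (FramedRep.conj D F) ?_ τ
      rw [FramedRep.matrixFn_conj]
      exact hcr.conj 𝔅₁ D

end Family


/-! ### The proof of Lemma 1.4.3 (1) -/

section Main

universe w

/-- **A continuous character of a compact group with values in `ℚ̄_pˣ` takes values of norm one**
(its image is bounded, and `‖χ(g)‖ ≠ 1` would make `‖χ(g^{±k})‖` unbounded).  Same statement and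
proof as `norm_unitsChar_eq_one_of_continuous` of `CrystallineOrdinaryShape.lean` (repeated here to
keep the import closure of this proof file small). [folklore] -/
theorem norm_unitsChar_eq_one_of_continuous' {G : Type*} [Group G] [TopologicalSpace G]
    [CompactSpace G] {p : ℕ} [Fact p.Prime] (χ : G →* (PadicAlgCl p)ˣ)
    (hχ : Continuous fun g => (χ g : PadicAlgCl p)) (g : G) : ‖(χ g : PadicAlgCl p)‖ = 1 := by
  obtain ⟨C, hC⟩ := (isCompact_range hχ.norm).bddAbove
  have hle : ∀ g : G, ‖(χ g : PadicAlgCl p)‖ ≤ 1 := fun g => not_lt.mp fun hlt => by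
    obtain ⟨k, hk⟩ := pow_unbounded_of_one_lt C hlt
    have hk' : ‖(χ g : PadicAlgCl p)‖ ^ k ≤ C := by
      have := hC (Set.mem_range_self (g ^ k))
      simpa only [map_pow, Units.val_pow_eq_pow_val, norm_pow] using this
    exact absurd hk' (not_le.mpr hk)
  refine le_antisymm (hle g) ?_
  have h1 := hle g⁻¹
  rw [map_inv, Units.val_inv_eq_inv_val, norm_inv] at h1
  exact (inv_le_one₀ (norm_pos_iff.mpr (Units.ne_zero _))).mp h1

set_option maxSynthPendingDepth 3 in
set_option maxHeartbeats 800000 in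
/-- **Barnet-Lamb–Gee–Geraghty–Taylor 2014, Lemma 1.4.3 (1), proved** (discharge of the named fact
`blggt2014_lemma_1_4_3_1`): a potentially crystalline `ρ : Γ_K → GL_n(ℚ̄_p)` with an invariant
complete flag is potentially diagonalizable.  Proof (following the printed one, BLGGT §1.4: "the
first part follows from item (semisimp)", i.e. `ρ ∼ ⊕ gr^i ρ` by the family `h ρ h⁻¹` over power
series, §1.3 proof of (dia)): restrict to the field `K₁` over which `ρ` is crystalline, put `ρ` in
upper-triangular form, take a finite `E₀/ℚ_p` containing all entries (Baire,
`exists_hasQlModel_holds`) and conjugate by `diag(p^{-mi})` to make the entries integral (the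
diagonal characters of a compact group have norm one); the connecting family
`exists_connectingFamily_of_integral` over `𝒪_{E₀}⟦t⟧` then connects `diag(p^{-i}) ρ diag(p^{i})`
to the crystalline sum of characters `⊕ gr^i ρ`, all of its points being crystalline after the
inner automorphism `absGaloisRestrict K₁ K₁` (`absGaloisRestrict_self_eq_conj`).
[cite: BarnetlambEtAl2014, §1.4 Lemma 1.4.3 (1)] -/
theorem blggt2014_lemma_1_4_3_1_holds : blggt2014_lemma_1_4_3_1.{w} := by
  intro p _ K _ _ _ 𝔅 n ρ hcris hflag
  classical
  obtain ⟨K₁, hK₁, hcr₀⟩ := hcris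
  obtain ⟨P, hP⟩ := hflag
  haveI := hK₁
  haveI : CompactSpace (absoluteGaloisGroup K₁) := absoluteGaloisGroup_compactSpace K₁
  -- Step 1: upper-triangular form over `K₁`
  let ρ₁ : FramedGaloisRep K₁ (PadicAlgCl p) n := FramedRep.conj P (ρ.restrictField K₁)
  have hU₁ : ρ₁.IsUpperTriangular := fun σ i j hij => hP (absGaloisRestrict K K₁ σ) i j hij
  have hcr₁ : IsCrystallineFn (𝔅 K₁ hK₁) (FramedRep.matrixFn ρ₁) := by
    rw [FramedRep.matrixFn_conj]
    exact hcr₀.conj (𝔅 K₁ hK₁) P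
  -- Step 2: a finite extension containing all entries
  obtain ⟨E₀, hE₀fin, hE₀⟩ := FramedGaloisRep.exists_finiteDimensional_forall_mem ρ₁
  haveI := hE₀fin
  -- Step 3: bound the entries and conjugate by `diag(p^{-mi})` to make them integral
  have hcont : ∀ i j, Continuous fun σ : absoluteGaloisGroup K₁ =>
      (ρ₁ σ : Matrix (Fin n) (Fin n) (PadicAlgCl p)) i j :=
    fun i j => (Units.continuous_val.comp (map_continuous ρ₁)).matrix_elem i j
  have hbdd : ∀ i j, ∃ C : ℝ, ∀ σ, ‖(ρ₁ σ : Matrix (Fin n) (Fin n) (PadicAlgCl p)) i j‖ ≤ C := by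
    intro i j
    obtain ⟨C, hC⟩ := (isCompact_range (hcont i j).norm).bddAbove
    exact ⟨C, fun σ => hC (Set.mem_range_self σ)⟩
  choose Cf hCf using hbdd
  set C : ℝ := ∑ i, ∑ j, |Cf i j| with hC
  have hCle : ∀ σ i j, ‖(ρ₁ σ : Matrix (Fin n) (Fin n) (PadicAlgCl p)) i j‖ ≤ C := by
    intro σ i j
    refine (hCf i j σ).trans ((le_abs_self _).trans ?_)
    rw [hC]
    refine le_trans ?_ (Finset.single_le_sum (f := fun i => ∑ j, |Cf i j|)
      (fun i _ => Finset.sum_nonneg fun j _ => abs_nonneg _) (Finset.mem_univ i))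
    exact Finset.single_le_sum (f := fun j => |Cf i j|) (fun j _ => abs_nonneg _) (Finset.mem_univ j)
  have hp1 : (1 : ℝ) < p := by exact_mod_cast (Fact.out : p.Prime).one_lt
  obtain ⟨m, hm⟩ := pow_unbounded_of_one_lt C hp1
  have hpn : ((p : ℕ) : PadicAlgCl p) ≠ 0 := by exact_mod_cast (Fact.out : p.Prime).ne_zero
  obtain ⟨D, hD, hD'⟩ := exists_generalLinearGroup_diagonal
    (fun i : Fin n => ((p : ℕ) : PadicAlgCl p)⁻¹ ^ (m * (i : ℕ))) fun i =>
      pow_ne_zero _ (inv_ne_zero hpn)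
  let ρ₂ : FramedGaloisRep K₁ (PadicAlgCl p) n := FramedRep.conj D ρ₁
  have hρ₂ : ∀ σ i j, (ρ₂ σ : Matrix (Fin n) (Fin n) (PadicAlgCl p)) i j =
      ((p : ℕ) : PadicAlgCl p) ^ (m * (j : ℕ) - m * (i : ℕ)) *
        (ρ₁ σ : Matrix (Fin n) (Fin n) (PadicAlgCl p)) i j := by
    intro σ i j
    change FramedRep.matrixFn (FramedRep.conj D ρ₁) σ i j = _
    rw [FramedRep.matrixFn_conj_apply, diagonal_conj_apply hD hD', FramedRep.matrixFn_apply]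
    exact inv_pow_mul_mul_inv_eq hpn fun h => hU₁ σ i j (by
      rw [Fin.lt_def]; exact Nat.lt_of_mul_lt_mul_left h)
  have hU₂ : ρ₂.IsUpperTriangular := fun σ i j hij => by
    rw [hρ₂, hU₁ σ i j hij, mul_zero]
  have hint₂ : ∀ σ i j, ‖(ρ₂ σ : Matrix (Fin n) (Fin n) (PadicAlgCl p)) i j‖ ≤ 1 := by
    intro σ i j
    rw [hρ₂]
    rcases lt_trichotomy i j with hij | rfl | hij
    · rw [norm_mul, norm_pow, norm_natCast_padicAlgCl]
      have h3 : m ≤ m * (j : ℕ) - m * (i : ℕ) := by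
        have h4 : m * ((i : ℕ) + 1) ≤ m * (j : ℕ) :=
          Nat.mul_le_mul_left m (by have := Fin.lt_def.1 hij; omega)
        rw [Nat.mul_succ] at h4
        generalize m * (i : ℕ) = a at h4 ⊢
        generalize m * (j : ℕ) = b at h4 ⊢
        omega
      calc (p : ℝ)⁻¹ ^ (m * (j : ℕ) - m * (i : ℕ)) * ‖(ρ₁ σ : Matrix (Fin n) (Fin n) (PadicAlgCl p)) i j‖
          ≤ (p : ℝ)⁻¹ ^ m * C := by
            refine mul_le_mul ?_ (hCle σ i j) (norm_nonneg _) (pow_nonneg (inv_nonneg.2 (by positivity)) _)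
            exact pow_le_pow_of_le_one (inv_nonneg.2 (by positivity)) (inv_le_one_of_one_le₀ hp1.le) h3
        _ ≤ (p : ℝ)⁻¹ ^ m * (p : ℝ) ^ m :=
            mul_le_mul_of_nonneg_left hm.le (pow_nonneg (inv_nonneg.2 (by positivity)) _)
        _ = 1 := by rw [← mul_pow, inv_mul_cancel₀ (by positivity), one_pow]
    · rw [Nat.sub_self, pow_zero, one_mul]
      exact (norm_unitsChar_eq_one_of_continuous' (hU₁.diagChar i) (ρ₁.continuous_diagEntry i) σ).le
    · rw [hU₁ σ i j hij, mul_zero, norm_zero]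
      exact zero_le_one
  have hpE₀ : ((p : ℕ) : PadicAlgCl p) ∈ E₀ := by
    rw [← map_natCast (algebraMap ℚ_[p] (PadicAlgCl p))]
    exact E₀.algebraMap_mem _
  have hE₂ : ∀ σ i j, (ρ₂ σ : Matrix (Fin n) (Fin n) (PadicAlgCl p)) i j ∈ E₀ ∧
      (((ρ₂ σ)⁻¹ : GL (Fin n) (PadicAlgCl p)) : Matrix (Fin n) (Fin n) (PadicAlgCl p)) i j ∈ E₀ := by
    have key : ∀ σ i j, (ρ₂ σ : Matrix (Fin n) (Fin n) (PadicAlgCl p)) i j ∈ E₀ := fun σ i j => by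
      rw [hρ₂]
      exact mul_mem (pow_mem hpE₀ _) (hE₀ σ i j).1
    intro σ i j
    refine ⟨key σ i j, ?_⟩
    rw [← map_inv]
    exact key σ⁻¹ i j
  have hcr₂ : IsCrystallineFn (𝔅 K₁ hK₁) (FramedRep.matrixFn ρ₂) := by
    rw [FramedRep.matrixFn_conj]
    exact hcr₁.conj (𝔅 K₁ hK₁) D
  -- Step 4: the connecting family
  obtain ⟨𝓕, δ, Dp, hδdiag, hδcr, -, hleft, hright, hpoints⟩ :=
    exists_connectingFamily_of_integral (𝔅 K₁ hK₁) ρ₂ hU₂ E₀ hE₂ hint₂ hcr₂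
  -- Step 5: conclusion
  have hconj3 : FramedRep.conj (Dp * D * P) (ρ.restrictField K₁) = FramedRep.conj Dp ρ₂ := by
    rw [← FramedRep.conj_conj, ← FramedRep.conj_conj]
  refine ⟨K₁, hK₁, Dp * D * P, ?_, δ, hδdiag, hδcr, ?_⟩
  · rw [hconj3, FramedRep.matrixFn_conj]
    exact hcr₂.conj (𝔅 K₁ hK₁) Dp
  · refine ⟨K₁, le_rfl, hK₁, 𝓕, 1, fun i j => ?_, ?_, hright, ?_⟩
    · simp only [inv_one, Units.val_one]
      by_cases hij : i = j
      · subst hij; simp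
      · simp [Matrix.one_apply_ne hij]
    · rw [hconj3]; exact hleft
    · intro y hy
      letI : Algebra K₁ K₁ := (IntermediateField.inclusion (le_refl K₁)).toRingHom.toAlgebra
      obtain ⟨τ, hτ⟩ := absGaloisRestrict_self_eq_conj K₁ (le_refl K₁)
      have e : (⇑(absGaloisRestrict K₁ K₁) : absoluteGaloisGroup K₁ → absoluteGaloisGroup K₁) =
          fun σ => τ * σ * τ⁻¹ := funext hτ
      change IsCrystallineFn (𝔅 K₁ hK₁) (𝓕.specialize y ∘ ⇑(absGaloisRestrict K₁ K₁))
      rw [e]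
      exact hpoints y hy τ

end Main

end Literature.NumberTheory.GaloisRepresentations

end
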